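/-
Copyright: lit-balaban Phase-2 proof seat p34 (gen 20).  Statement-level skeleton of a published paper; no proof claims beyond what the
kernel checks below.
-/
import Literature.MathematicalPhysics.QuantumFieldTheory.BalabanImbrieJaffe1984to88.BIJ88NeumannPropagatorSmallFieldCubeHolderDecay
import Literature.MathematicalPhysics.QuantumFieldTheory.BalabanImbrieJaffe1984to88.BIJ88NeumannPropagatorActualBackground

/-!
# [Balaban1983RegularityDecay] Theorem p. 573 (1.9) / [BalabanImbrieJaffe1988] p. 263 / [BalabanImbrieJaffe1985] §7.3 p. 326 — **THE HÖLDER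
# MEMBER (ORDER `1+α`) OF [6] (1.9) FOR THE COVARIANT DERIVATIVE OF THE REGION NEUMANN PROPAGATORS `G_k(Ω,u)` ON A GENERAL `k`-BLOCK UNION
# `Ω` AT SMALL NON-FLAT `U(1)` FIELDS, `k`-UNIFORM OPERATOR (`‖f‖_∞`) FORM, ALL DEEP PAIRS — and the same under (7.3.1)-type fine-plaquette
# smallness only, and AT THE ACTUAL BACKGROUND `u_k` of (4.5.4) under the printed (7.3.1)**

T. Bałaban, *Regularity and decay of lattice Green's functions*, Commun. Math. Phys. **89** (1983) 571–597 [Balaban1983RegularityDecay] (= [6] of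
[BalabanImbrieJaffe1988], [7] of [BalabanImbrieJaffe1985]), Theorem p. 573 [PDF 3], (1.9): *"Finally for an arbitrary pair of points x, x′ ∈ ηZ^d,
let us denote by Γ_{x,x′} a shortest contour connecting these points. … For α < 1 there exist positive constants δ₀, c₀, R₀ independent of A,
k, Ω and depending on d, M only, c₀ on α also, such that … 1/|x − x′|^α |U(A(Γ_{x,x′}))(D^η_{A,μ}G_k(Ω,A)f)(x′) − (D^η_{A,μ}G_k(Ω,A)f)(x)| ≦
c₀exp(−δ₀dist({x,x′}, supp f))‖f‖_∞ (1.9) for x, x′ ∈ Ω, and satisfying the condition dist({x,x′},Ω^c) ≧ R₀"*; T. Bałaban, J. Imbrie,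
A. Jaffe, *Effective action and cluster properties of the abelian Higgs model*, Commun. Math. Phys. **114** (1988) 257–315
[BalabanImbrieJaffe1988], p. 263 [PDF 7]: *"G_k(u; x₁, x₂) = Σ_α λ_α G_k(□_α, u; x₁, x₂) (2.27) as a convex combination of Neumann
propagators. … Bounds analogous to (2.30), (2.31) hold for covariant derivatives and Hölder derivatives of G_{k,loc}(u) of order less than
two."*; [I] = T. Bałaban, J. Imbrie, A. Jaffe, *Renormalization of the Higgs model: minimizers, propagators and the stability of mean field
theory*, Commun. Math. Phys. **97** (1985) 299–329 [BalabanImbrieJaffe1985], §7.3 p. 326 [PDF 28]: *"In particular, let us assume that for the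
unit lattice field v, |v(∂p) − 1| ≦ e_k𝓅(e_k), (7.3.1) … The propagators arising from Δ_k(u_k), under the restriction (7.3.1) on the gauge
field, also satisfy the regularity and decay estimates of [7]. In order to remain within the framework of this reference, we remark that by
change of gauge u_k can be transformed in a local region Λ into a configuration of the form exp[ie_kηA], where A is smooth and small."*

statement-level skeleton of published theorems with citation tags; proofs where landed; nothing here is a claim about the Yang–Mills mass gap

PDFs held: `paper:balaban1983-cmp89-regularity-decay` (journal page = PDF page + 570; p. 573 [PDF 3]);
`paper:balaban1988-cmp114-bij-abelian-higgs-effective-action` (journal page = PDF page + 256; p. 263 [PDF 7]);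
`paper:balaban1985-cmp97-bij-higgs-minimizers` (journal page = PDF page + 298; p. 326 [PDF 28], p. 313 [PDF 15] for (4.5.4)).

CITATION HEADER (lean-in-tree rule).  Part of the lit-balaban TYPED SKELETON (HOME `run/shared/lean/pub/lit-balaban/`), PHASE-2 proof seat
p34 gen 20 (unit `lit-balaban-p34-g20`; TAKING line HOME/STATUS.md 2026-08-23T10:22:51Z; free-target protocol G.5-34(d) — source: the C2
owner's `HOME/lit-balaban-r18/C2S14-CLOSURE.md` v1.18 §6 coverage matrix, row «small-plaquette U(1) field ∣ general k-block Ω ⊇ Ω₀ ∣ H1θ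
OPEN» and row «actual background u_k … ∣ H1θ OPEN», whose missing [6]-input (H6) — the (1.9) Hölder member of `G_k(Ω,u)` for a GENERAL
`k`-block union at small fields — this file supplies; p27 gen 38's TAKING #1 (2026-08-23T09:15:21Z) names it as «not in the tree»).  WHAT IS
REPRODUCED: a located MEMBER of rows **C2.Claim@263** / **C2.Eq2.30** (owner r18) and **C1.Eq7.3.1-7.3.2** (owner r15; C1-CLOSURE §5 item 3
«the REGION form G_k(Ω, u_k)»): the REGION twin of p27 gen 35's cube files `BIJ88NeumannPropagatorSmallFieldCubeHolder` (p351200) /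
`BIJ88NeumannPropagatorSmallFieldCubeHolderDecay` (p351875) and of p30 gen 26's torus files `BIJ85ScalarPropagatorSupDecayHolder` (p349509) /
`BIJ85ScalarPropagatorHolderDecay` (p350355), with the cube inputs replaced by p34 gen 18's REGION inputs (`decay110_smallField_region`,
p354902/p356532; `decay110_smallField_region_deriv`, p357088); §5 puts the member at the actual background `u_k = u_k(e_k, v)` of (4.5.4) under
the PRINTED (7.3.1) by p34 gen 19's `smallPlaquette_actualBg` (p359041).  No row is restated and no head changes.  USED BY NAME, never
restated: p27's `source_eq_on_ball` / `deep_of_ball` (`BIJ88NeumannPropagatorSmallFieldCubeHolder` — already stated for block unions),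
`stairHol_gaugeAct` (`BIJ88NeumannPropagatorSmallFieldCubeHolderDecay`); p30's `local_holder_bound` / `div_rpow_mul_eq` / `rpow_neg_le_of_le_mul`
/ `rpow_le_mul_rpow` (`BIJ85ScalarPropagatorSupDecayHolder`), `flat_kernel_holder` (`BIJ85FlatPropagatorKernelHolder`), `centredGaugeDir` /
`dist1_centredGaugeDir_le(_min)` (`BIJ85BiCentredAxialGauge`), `axisHol` / `axisHol_zero` / `axisHol_gaugeAct` / `toC_axisHol_eq_one` /
`covD_gaugeAct` / `runSite_apply_ne` / `supDist_runSite_eq` / `stairPt*` / `min_val_le_supDist` / `legHol` / `stairHol` / `norm_stairHol` /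
`stair_telescope` (`BIJ85ScalarPropagatorHolderDecay`), `norm_covDiff_gaugeAct` / `two_mul_pow_le_sitesPerDir` / `gamma_nsq_le_one`
(`BIJ85ScalarPropagatorSupDecayDeriv`), `supDist_shift_le_succ` / `supDist_unshift_le_succ` (`BIJ85TorusTentCutoff`); p34's
`decay110_smallField_region` (gen 18, `BIJ88NeumannPropagatorSmallFieldRegionSup`), `decay110_smallField_region_deriv` (gen 18,
`BIJ88NeumannPropagatorSmallFieldRegionDeriv`), `gBox_gaugeAct_mulVec` / `norm_toC_plaqHol_gaugeAct_sub_one` (gen 17,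
`BIJ88NeumannPropagatorSmallFieldCubeDeriv`), `smallField_blockGauge` (gen 16 v1.2, `BIJ88NeumannPropagatorSmallPlaquetteRegion`),
`smallPlaquette_actualBg` (gen 19, `BIJ88NeumannPropagatorActualBackground`); p31's `nOp` / `gBox` / `IsBlockUnion`; p38's `B5Ineq137Torus.T`
with `B3Bound323ZeroTorus.T_eq_supDist`; r15/p11's `actualBgU1` (`BIJ85Eq454PlaqResidual`), `U1Field` / `plaq` (`BIJ85Sect1Model`).  Kind:
theorems only (no definition, no `Prop`-valued fact).

THE MATHEMATICS (ours — DIVERGENCE OF METHOD from the printed route, disclosed as in p27's/p30's/p34's files: the print defers to an extension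
of [6]'s random-walk expansion; here p30's perturbative interior Hölder estimate, transplanted from the torus to a region exactly as p34 gen 18
transplanted the gradient estimate and p27 gen 35 the cube Hölder estimate).  p27's cube proofs used the cube `□` ONLY through (a) the VALUE
member in operator form at every site, (b) the COVARIANT-DERIVATIVE member at the `L^k`-deep bonds, (c) `IsBlockUnion k □` (for the interior
reading of the region equation by the torus operator, `source_eq_on_ball`) and (d) the depth of the pair to the complement — and (a), (b) exist
for an arbitrary `k`-block union `Ω` since p34 gen 18 (`decay110_smallField_region`, `decay110_smallField_region_deriv`, same hypotheses, same
shapes).  So: fix `φ = G_k(Ω,u)f`, an axis-parallel pair `x₁ = x₀ + ρe_i` (`1 ≤ ρ`, `64ρ ≤ L^k`) with `x₀` `2L^k`-deep in `Ω`, the radius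
`r = ⌊L^k/8⌋` and p30's axis-rooted tree gauge `h = centredGaugeDir u x₀ (2r) i`; the torus source `N_T(u^h)(hφ)` equals `hf` on the
`2r`-ball (all its sites have their bonds in `Ω`), so p30's `local_holder_bound` applies verbatim with `S` = the region value bound, `M_loc` =
the region `D_u` bound on the (all `L^k`-deep) bonds of the ball, the gauge weight `γ = dθ` and p30's flat Hölder envelopes — p30's/p27's
arithmetic line by line (§1).  Gauge covariance of the three factors gives the invariant leg estimate (§2); p30's shortest staircase of `d+1`
axis legs, all of whose corners are within `|x₀−x₁|_∞ ≤ L^k/64` of `x₀` (hence `2L^k`-deep when the pair is `3L^k`-deep), telescopes the near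
pairs, and the region `D_u` member at both bonds settles the far pairs (§3).  The blockwise centred gauge of [I] p. 326 (p34's
`smallField_blockGauge`) removes the bondwise hypotheses at a `(d, L^k)`-only threshold (§4), and p34 gen 19's passage `smallPlaquette_actualBg`
((7.3.1) on `v` ⇒ every fine plaquette of `u_k` within `K·e𝓅(e)/(L^k)²` of `1`, all side conditions at one threshold) puts the member at the
actual background (§5).

WHAT IS PROVED (theorems only; 0 `sorry`; standard axioms; no definition, no `Prop`-valued fact).
* §1 **`holder19_region_leg_gauged`** — p27's `holder19_cube_leg_gauged` for a general `k`-block union `Ω`: in the axis-rooted gauge every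
  axis bond is trivial and `‖(ψ(x₁+e_μ) − ψ(x₁)) − (ψ(x₀+e_μ) − ψ(x₀))‖ ≤ c₀(|x₀−x₁|_∞/L^k)^α(L^kε)·ε·e^{−t₀D/L^k}F`, `ψ = h·G_k(Ω,u)f`.
* §2 **`holder19_region_leg`** — the gauge-invariant (1.9) bound at an axis-parallel `2L^k`-deep pair `x, x+ρe_i` (`1 ≤ ρ ≤ L^k/64`) of `Ω`.
* §3 **`holder19_smallField_region`** — for `1 ≤ d`, `d + 1 ≤ 3`, `L` odd `> 1`, `a > 0`, `0 ≤ α < 1` THERE EXIST `t₀, c₀ > 0` (on `d, L, a, α`)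
  such that for every `P` (`P.d = d+1`, `P.L = L`), every `1 ≤ k ≤ K`, EVERY `k`-block union `Ω`, every `U(1)` field with p34's region
  hypotheses (plaquettes within `θ`, `2(d+1)³(L^{2k}θ)² ≤ 1`; bondwise `(T, δ)` on `Ω`), every pair `x₀ ≠ x₁` BOTH `3L^k`-DEEP in `Ω`, every
  direction `μ` and every `f` with `|f| ≤ F` vanishing at sup-distance `< D` from `{x₀, x₁}`:
  `(L^k/|x₀−x₁|_∞)^α·‖U(Γ_{x₀,x₁})(D_uG_k(Ω,u)f)(⟨x₁,μ⟩) − (D_uG_k(Ω,u)f)(⟨x₀,μ⟩)‖ ≤ c₀(L^kε)e^{−t₀D/L^k}F`, `Γ` = p30's `stairHol`;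
  **`holder19_smallField_region_input`** (ball-condition binder shape of p27's `holder19_smallField_cube_input`);
  **`holder19_smallField_region_H6`** — VERBATIM the (H6) binder shape of p27 gen 38's `derivHolder231_region_of_inputs_of_smooth` (depth as
  `∀ w ∉ Ω, ρ ≤ T(x_i, w)` at any `ρ ≥ 3L^k`, `x₁ ∈ Ω`, `x₂ ∈ Ω`, `0 ≤ D`, two one-sided support conditions).
* §4 **`holder19_smallPlaquette_region_uniform`** (+ **`_input`**, **`_H6`**) — §3 under (7.3.1)-TYPE fine-plaquette smallness ONLY:
  `2(L^k−1)+4 < |T|`, `‖u(∂p) − 1‖ ≤ θ` for all fine plaquettes, `2(d+1)³(L^{2k}θ)² ≤ 1`, `T ≥ d(L^k−1)θ` with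
  `2(L^k−1)L^k(d+1)T² + 2((d+1)(L^k−1)T)² ≤ 1/2`; NO gauge condition, no ball — uniform in the region, the volume and the field.
* §4 (cont.) **`holder19_smallPlaquette_region_H6_of500`** — the same (H6) shape in the `((L^k)²θ)² ≤ 1/500` / `plaqC` currency of the
  hypothesis-free region chain (p30's `inputs110_smallPlaquette_region`, p27's `closeHolder112_smallPlaquette_region`, p29's
  `inputs_smallPlaquette_region`; parameters `(d ℓ)`, `P.L = ℓ+1` odd), so that (H1)–(H6) of p27's FILE 1b come in ONE currency.
* §5 **`holder19_region_actualBg`** (+ **`_H6`**) — AT THE ACTUAL BACKGROUND `u_k = actualBgU1 hd2 k e v` of [I] (4.5.4) UNDER THE PRINTED (7.3.1)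
  `‖v(∂q) − 1‖ ≤ e𝓅(e)` on the unit field `v`, ONE threshold `e𝓅(e) ≤ c₁ = 1/(23D²K(D, L))`, every `k`-block union `Ω`, every torus.

HONEST SCOPE.  (i) DEEP PAIRS ONLY: both end points `3L^k`-deep (`∀ w ∉ Ω, 3L^k ≤ |x−w|_∞`) — [6]'s *"dist({x,x′},Ω^c) ≥ R₀"* with `R₀` =
three units of the `L^{−k}`-lattice; [6]'s remark that rectangular parallelepipeds need no restriction is NOT reproduced (boundary layer:
reflected kernels (2.42) of [6], not done — as in p34's/p27's/p30's files).  (ii) `P.d = d+1 ∈ {2,3}` (p27's tilted row / p34's region value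
member need `≤ 3`, p30's flat envelopes need `≥ 2`), `L` odd `> 1`, `1 ≤ k ≤ K`, `0 ≤ α < 1` (referee ruling G-ref1-32 on the printed «α < 0»);
the contour is p30's explicit shortest staircase (the print allows any shortest contour); ONE power of `L^kε` on the right, as the `D_u`
member.  (iii) §3's hypotheses are the UNION of the region value member's (bondwise `(T, δ)` on `Ω`) and the region `D_u` member's (plaquette
`θ`); §4 removes the bondwise part at the `(d, L^k)`-only threshold; §5's hypothesis is THE PRINTED (7.3.1) on the UNIT-lattice plaquettes of
`v` (p. 326 L13–14) through gen 19's passage (p33's all-tori `K_R` inside; threshold `e𝓅(e) ≤ 1/(23D²K)` with `K = (π/2)K_R(D, L)` not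
evaluated); §§1–4's `θ` constrains the FINE plaquettes of `u` (referee ref-5 D-g64-1).  (iv) No (1.11)–(1.12) closeness Hölder member here
(p27's `closeHolder112_smallPlaquette_region`, p358926) and no (2.31)/(2.30) Hölder member of `G_{k,loc}` (p27 gen 38's hypothesis form
`derivHolder231_region_of_inputs_of_smooth` takes this file's §3/§4/§5 `_H6` theorems as its input (H6); the instances are p27's/p29's lane).
(v) Constants explicit in the proofs (§1 `t₀ = min(t_v, t_d, 1)`, `c₀ = C_LC_H(e + c_de + c_ve³ + 256c_ve³ + 2ac_ve³) + 1`; §3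
`t₀ = min(t_leg, t_d)`, `c₀ = (d+1)c_leg e^{t_leg} + 128c_d + 1`) — p30's/p27's formulas with the region constants; `set_option maxHeartbeats`
800000 on §1 and 400000 on §3 (p30's bookkeeping verbatim).  DIVERGENCE OF METHOD as stated.  Literature + Mathlib only.  Nothing here is summit
progress, continuum or Clay.  Unit `lit-balaban-p34` (literature-prover-lit-balaban-p34-g20-0), HOME `run/shared/lean/pub/lit-balaban/`,
2026-08-23.
-/

open scoped BigOperators ComplexConjugate
open Finset Matrix

namespace Literature.MathematicalPhysics.QuantumFieldTheory.BalabanImbrieJaffe1984to88.BIJ88NeumannPropagatorSmallFieldRegionHolder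

open Literature.MathematicalPhysics.QuantumFieldTheory.Balaban1983to89
open LatticeFieldCalculus (supDist runSite runSite_zero runSite_succ)
open B3TorusRadialSums (cdist cdist_le_supDist supDist_comm supDist_eq_sup_cdist supDist_eq_zero_iff cdist_neg cdist_eq_zero_iff)
open BIJ85Ineq722Torus (supDist_triangle supDist_runSite_le)
open BIJ88Sect3Statements (U1 toC cfg covD starB mem_starB norm_toC toC_one toC_mul toC_inv)
open BIJ85BlockAveragesTorusK (blkIter cornerIter holCK)
open BIJ88NeumannNoZeroModesTorus (IsBlockUnion)
open BIJ88NeumannPropagator227Torus (nOp gBox conj_mul_toC toC_mul_conj)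
open GaugeField (gaugeAct plaqHol)
open BIJ85CentredAxialGauge (centredGauge)
open BIJ85ScalarPropagatorSupDecayDeriv (norm_covDiff_gaugeAct dist1_plaqHol_le_of_plaqC two_mul_pow_le_sitesPerDir gamma_nsq_le_one)
open BIJ85TorusTentCutoff (supDist_shift_le_succ supDist_unshift_le_succ supDist_shift_le_one')
open BIJ85BiCentredAxialGauge (centredGaugeDir dist1_centredGaugeDir_le dist1_centredGaugeDir_le_min)
open BIJ85ScalarPropagatorSupDecayHolder (local_holder_bound div_rpow_mul_eq rpow_neg_le_of_le_mul rpow_le_mul_rpow)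
open BIJ85ScalarPropagatorHolderDecay (axisHol axisHol_zero axisHol_gaugeAct toC_axisHol_eq_one covD_gaugeAct runSite_apply_ne
  supDist_runSite_eq stairPt stairPt_zero stairPt_of_le supDist_stairPt_le stairPt_succ_eq_runSite stairPt_eq_runSite_succ
  min_val_le_supDist legHol stairHol norm_stairHol stair_telescope)
open BIJ88NeumannPropagatorSmallFieldRegionSup (decay110_smallField_region)
open BIJ88NeumannPropagatorSmallFieldRegionDeriv (decay110_smallField_region_deriv)
open BIJ88NeumannPropagatorSmallFieldCubeDeriv (gBox_gaugeAct_mulVec norm_toC_plaqHol_gaugeAct_sub_one)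
open BIJ88NeumannPropagatorSmallPlaquetteRegion (smallField_blockGauge)
open BIJ88NeumannPropagatorSmallFieldCubeHolder (source_eq_on_ball deep_of_ball)
open BIJ88NeumannPropagatorSmallFieldCubeHolderDecay (stairHol_gaugeAct)
open BIJ88NeumannPropagatorActualBackground (smallPlaquette_actualBg)
open BIJ85Eq454PlaqResidual (actualBgU1)

noncomputable section

variable {P : Params}

/-! ## §1 [6] (1.9): the HÖLDER member at an axis-parallel DEEP pair of a `k`-block union, in the axis-rooted gauge, `k`-uniform -/

section LegGauged

variable {d : ℕ}

set_option maxHeartbeats 800000 in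
/-- **THE HÖLDER MEMBER OF [6] (1.9) FOR THE COVARIANT DERIVATIVE OF THE REGION NEUMANN PROPAGATOR `G_k(Ω,u)` ON A GENERAL `k`-BLOCK UNION AT
SMALL NON-FLAT FIELDS, AXIS-PARALLEL DEEP PAIRS, IN THE AXIS-ROOTED GAUGE, `k`-UNIFORM** — for [BalabanImbrieJaffe1988] p. 263 *"Bounds analogous
to (2.30), (2.31) hold for covariant derivatives and Hölder derivatives of G_{k,loc}(u) of order less than two"*, [BalabanImbrieJaffe1985] p. 326
*"The propagators arising from Δ_k(u_k), under the restriction (7.3.1) on the gauge field, also satisfy the regularity and decay estimates of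
[7]"* and [Balaban1983RegularityDecay] (1.9) *"|x−x′|^{−α}|U(A(Γ_{x,x′}))(D^η_{A,μ}G_k(Ω,A)f)(x′) − (D^η_{A,μ}G_k(Ω,A)f)(x)| ≤
c₀e^{−δ₀dist({x,x′},supp f)}‖f‖_∞ … dist({x,x′},Ω^c) ≥ R₀"*, for p31's REGION propagator of record `G_k(Ω,u) = gBox (α_kL^{kd}) ε⁻¹ u k Ω` on an
ARBITRARY union `Ω` of `k`-blocks (`IsBlockUnion k Ω`), under the union of the hypotheses of p34's region value member
(`decay110_smallField_region`: bondwise `(T, δ)` on `Ω`) and of p34's region derivative member (`decay110_smallField_region_deriv`: plaquettes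
within `θ` of `1`, `2(d+1)³(L^{2k}θ)² ≤ 1`): for `1 ≤ d`, `d + 1 ≤ 3`, `L` odd `> 1`, `a > 0`, `0 ≤ α < 1` there are `t₀, c₀ > 0` (on `d, L, a, α`)
such that for every volume, every `1 ≤ k ≤ K`, every `k`-block union `Ω`, every such field, every AXIS-PARALLEL pair `x₀`, `x₁` (`x₁,ν = x₀,ν` for
`ν ≠ i`) with `1 ≤ |x₀−x₁|_∞`, `64|x₀−x₁|_∞ ≤ L^k` and `dist_∞(x₀, T∖Ω) ≥ 2L^k` ([6]'s `R₀` = two units of the `L^{−k}`-lattice), every direction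
`μ` and every `f` with `|f| ≤ F` vanishing at sup-distance `< D` from `x₀`, in p30's tree gauge `h = centredGaugeDir u x₀ (2⌊L^k/8⌋) i` EVERY bond
based on the axis segment is trivial and, for `ψ = h·G_k(Ω,u)f`,
`‖(ψ(x₁+e_μ) − ψ(x₁)) − (ψ(x₀+e_μ) − ψ(x₀))‖ ≤ c₀(|x₀−x₁|_∞/L^k)^α(L^kε)·ε·e^{−t₀D/L^k}F`.  PROOF = p27 gen 35's `holder19_cube_leg_gauged`
VERBATIM with the cube replaced by `Ω` (that proof used the cube only through the value member, the `D_u` member at `L^k`-deep bonds,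
`IsBlockUnion` and the depth to the complement): p30's `local_holder_bound` at `r = ⌊L^k/8⌋` applied to the torus operator `N_T(u^h)` and `ψ`,
whose torus source equals `hf` on the `2r`-ball (p27's `source_eq_on_ball`, stated for block unions); `S` from the region value bound, `M_loc`
from the region derivative bound (bonds of the `2r`-ball are `L^k`-deep, p27's `deep_of_ball`), the axis-rooted gauge weight `γ = dθ`
(`d = P.d − 1`) and p30's flat Hölder envelopes `A = C_Hε²ρ^α`; p30's arithmetic verbatim.
[cite: Balaban1983RegularityDecay, Theorem p.573 (1.9)] [cite: BalabanImbrieJaffe1988, p.263] [cite: BalabanImbrieJaffe1985, (7.3.1) p.326] -/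
theorem holder19_region_leg_gauged (d L : ℕ) (hd1 : 1 ≤ d) (hd3 : d + 1 ≤ 3) (hL : Odd L ∧ 1 < L) {a : ℝ} (ha : 0 < a) {α : ℝ}
    (hα0 : 0 ≤ α) (hα1 : α < 1) :
    ∃ t₀ c₀ : ℝ, 0 < t₀ ∧ 0 < c₀ ∧ ∀ (P : Params), P.d = d + 1 → P.L = L →
      ∀ k : ℕ, 1 ≤ k → k ≤ P.K → ∀ Ω : Finset (Balaban1983to89.Site P 0), IsBlockUnion k Ω →
        ∀ (U : GaugeField P 0 U1) (θ T δ : ℝ), 0 ≤ θ →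
          (∀ p : Balaban1983to89.Plaq P 0, ‖toC (GaugeField.plaqHol U p) - 1‖ ≤ θ) →
          2 * (P.d : ℝ) ^ 3 * (((P.L : ℝ) ^ k) ^ 2 * θ) ^ 2 ≤ 1 →
          (∀ b ∈ starB Ω, blkIter k b.src = blkIter k b.tgt → ‖toC (U b) - 1‖ ≤ T) →
          (∀ y ∈ Ω, ‖holCK U k y - 1‖ ≤ δ) →
          2 * (((P.L : ℝ) ^ k - 1) * (P.L : ℝ) ^ k) * P.d * T ^ 2 + 2 * δ ^ 2 ≤ 1 / 2 →
        ∀ (x₀ x₁ : Balaban1983to89.Site P 0) (i μ : Fin P.d), (∀ ν, ν ≠ i → x₁ ν = x₀ ν) →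
          1 ≤ supDist x₀ x₁ → 64 * supDist x₀ x₁ ≤ P.L ^ k →
          (∀ w, w ∉ Ω → 2 * P.L ^ k ≤ supDist x₀ w) →
        ∀ (f : Balaban1983to89.Site P 0 → ℂ) (F D : ℝ),
          (∀ z, ‖f z‖ ≤ F) → (∀ z, f z ≠ 0 → D ≤ (supDist x₀ z : ℝ)) →
          (∀ (z : Balaban1983to89.Site P 0) (μ' : Fin P.d), (∀ ν, ν ≠ i → z ν = x₀ ν) → supDist x₀ z ≤ supDist x₀ x₁ →
              cfg (GaugeField.gaugeAct (centredGaugeDir U x₀ (2 * (P.L ^ k / 8)) i) U) ⟨z, μ'⟩ = 1) ∧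
          ‖(toC (centredGaugeDir U x₀ (2 * (P.L ^ k / 8)) i (x₁.shift μ)) *
                (gBox (B1RG242Torus.α P a k * (P.L : ℝ) ^ (k * P.d)) P.eps⁻¹ U k Ω *ᵥ f) (x₁.shift μ) -
              toC (centredGaugeDir U x₀ (2 * (P.L ^ k / 8)) i x₁) *
                (gBox (B1RG242Torus.α P a k * (P.L : ℝ) ^ (k * P.d)) P.eps⁻¹ U k Ω *ᵥ f) x₁) -
            (toC (centredGaugeDir U x₀ (2 * (P.L ^ k / 8)) i (x₀.shift μ)) *
                (gBox (B1RG242Torus.α P a k * (P.L : ℝ) ^ (k * P.d)) P.eps⁻¹ U k Ω *ᵥ f) (x₀.shift μ) -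
              toC (centredGaugeDir U x₀ (2 * (P.L ^ k / 8)) i x₀) *
                (gBox (B1RG242Torus.α P a k * (P.L : ℝ) ^ (k * P.d)) P.eps⁻¹ U k Ω *ᵥ f) x₀)‖
            ≤ c₀ * ((supDist x₀ x₁ : ℝ) / (P.L : ℝ) ^ k) ^ α * P.spacing k * P.eps * Real.exp (-(t₀ * D / (P.L : ℝ) ^ k)) * F := by
  classical
  obtain ⟨t₁, c_v, ht₁, hc_v, hval⟩ := decay110_smallField_region d (L - 1) hd3 (by omega) ha
  obtain ⟨t₂, c_d, ht₂, hc_d, hder⟩ := decay110_smallField_region_deriv d L hd1 hd3 hL ha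
  obtain ⟨C_H, hCH, hhol⟩ := BIJ85FlatPropagatorKernelHolder.flat_kernel_holder (d + 1) L (by omega) hL ha (le_refl (0 : ℝ)) hα0 hα1
  obtain ⟨C_L, hCL, hloc⟩ := local_holder_bound (d + 1) (by omega) hα0 hα1
  -- the rate and the constant
  set t : ℝ := min (min t₁ t₂) 1 with htdef
  have ht : 0 < t := lt_min (lt_min ht₁ ht₂) one_pos
  have ht1 : t ≤ 1 := min_le_right _ _
  have htt₁ : t ≤ t₁ := (min_le_left _ _).trans (min_le_left _ _)
  have htt₂ : t ≤ t₂ := (min_le_left _ _).trans (min_le_right _ _)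
  set e : ℝ := Real.exp 1 with hedef
  have he1 : 1 ≤ e := by rw [hedef]; exact Real.one_le_exp (by norm_num)
  have he0 : 0 < e := Real.exp_pos 1
  set K₁ : ℝ := C_L * C_H * (e + c_d * e + c_v * e ^ 3 + 256 * c_v * e ^ 3 + 2 * a * c_v * e ^ 3) with hK₁
  refine ⟨t, K₁ + 1, ht, by positivity, ?_⟩
  intro P hPd hPL k hk1 hkK Ω hΩ U θ T δ hθ0 hθ hsmall hInt hTree hsmallT x₀ x₁ i μ hx₁ hρ1 hρ64 hdeep f F D hF hsupp
  have hk : k ≤ P.m + P.K := hkK.trans (Nat.le_add_left _ _)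
  have hk0 : 0 + k ≤ P.m + P.K := by omega
  have hPL' : P.L = L - 1 + 1 := by omega
  have hvalP := hval P hPd hPL' k hk1 hk Ω hΩ U T δ hInt hTree hsmallT
  have hderP := hder P hPd hPL k hk1 hkK Ω hΩ U θ T δ hθ0 hθ hsmall hInt hTree hsmallT
  have hholP := hhol P hPd hPL k hk1 hkK
  -- basic quantities
  have hd1' : 1 ≤ P.d := by omega
  have hLpos : (0 : ℝ) < P.L := P.cast_L_pos
  have hL1 : (1 : ℝ) < P.L := B1RG242Torus.one_lt_cast_L P
  have hε : 0 < P.eps := P.eps_pos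
  set n : ℝ := (P.L : ℝ) ^ k with hndef
  have hn : 0 < n := pow_pos hLpos k
  have hnnat : ((P.L ^ k : ℕ) : ℝ) = n := by push_cast; rw [hndef]
  have hsp : P.spacing k = n * P.eps := rfl
  have hsp0 : 0 < P.spacing k := P.spacing_pos k
  have hα : 0 < B1RG242Torus.α P a k := mul_pos (B1.aSeq_pos ha hL1 hk1) (inv_pos.2 (pow_pos hsp0 2))
  have hαa : B1RG242Torus.α P a k * P.spacing k ^ 2 ≤ a := by
    show B1.aSeq a P.L k * (P.spacing k ^ 2)⁻¹ * P.spacing k ^ 2 ≤ a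
    rw [inv_mul_cancel_right₀ (pow_ne_zero 2 hsp0.ne')]
    exact B1.aSeq_le ha hL1 k hk1
  set a' : ℝ := B1RG242Torus.α P a k * (P.L : ℝ) ^ (k * P.d) with ha'def
  have ha' : 0 < a' := mul_pos hα (pow_pos hLpos _)
  have hc' : P.eps⁻¹ ≠ 0 := inv_ne_zero hε.ne'
  have hF0 : 0 ≤ F := (norm_nonneg _).trans (hF x₀)
  have hplaq : ∀ p : Balaban1983to89.Plaq P 0, dist1 (GaugeField.plaqHol U p) ≤ θ := fun p => by
    rw [BIJ88Smooth43Axial.dist1_eq_norm_toC_sub_one]; exact hθ p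
  set φ := gBox a' P.eps⁻¹ U k Ω *ᵥ f with hφ
  -- the pair distance and the radius
  set ρ : ℕ := supDist x₀ x₁ with hρdef
  have hρ0 : (0 : ℝ) < ρ := by exact_mod_cast hρ1
  have hρn : 64 * (ρ : ℝ) ≤ n := by rw [← hnnat]; exact_mod_cast hρ64
  set r : ℕ := P.L ^ k / 8 with hrdef
  have hr8 : 8 * r ≤ P.L ^ k := Nat.mul_div_le (P.L ^ k) 8
  have hr8' : P.L ^ k < 8 * (r + 1) := by rw [hrdef]; omega
  have hrn : 8 * (r : ℝ) ≤ n := by rw [← hnnat]; exact_mod_cast hr8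
  have hrn' : n ≤ 8 * r + 8 := by
    have h : ((P.L ^ k : ℕ) : ℝ) ≤ ((8 * (r + 1) : ℕ) : ℝ) := by exact_mod_cast hr8'.le
    rw [hnnat] at h; push_cast at h; linarith
  have hρ1' : (1 : ℝ) ≤ ρ := by exact_mod_cast hρ1
  have hn1 : (1 : ℝ) ≤ n := by linarith
  have hr7 : (7 : ℝ) ≤ r := by linarith
  have hr4 : 4 ≤ r := by exact_mod_cast (show (4 : ℝ) ≤ r by linarith)
  have hr0 : (0 : ℝ) < r := by linarith
  have hr16 : n ≤ 16 * r := by linarith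
  have hρr : 2 * ρ + 4 ≤ r := by
    have h1 : 2 * (ρ : ℝ) + 4 ≤ r := by linarith
    exact_mod_cast h1
  have hN' : 4 * r + 6 ≤ P.sitesPerDir 0 := by
    have h1 := two_mul_pow_le_sitesPerDir (P := P) hk
    omega
  have hRb : 2 * (2 * r) + 4 < P.sitesPerDir 0 := by omega
  -- the deep ball: the `(2r+1)`-ball lies in `□`, the bonds of the `2r`-ball are `L^k`-deep
  obtain ⟨hinΩ, hdeepz⟩ := deep_of_ball (P := P) hr8 hdeep
  -- exponential bookkeeping
  set E : ℝ := Real.exp (-(t * D / n)) with hEdef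
  have hE0 : 0 < E := Real.exp_pos _
  have hexpD : ∀ {D₁ D₂ : ℝ}, D₂ ≤ D₁ → Real.exp (-(t * D₁ / n)) ≤ Real.exp (-(t * D₂ / n)) := fun h =>
    Real.exp_le_exp.2 (by rw [neg_le_neg_iff]; exact div_le_div_of_nonneg_right (mul_le_mul_of_nonneg_left h ht.le) hn.le)
  have hexp_t₁ : ∀ {D' : ℝ}, 0 ≤ D' → Real.exp (-(t₁ * D' / n)) ≤ Real.exp (-(t * D' / n)) := fun hD' =>
    Real.exp_le_exp.2 (by rw [neg_le_neg_iff]; exact div_le_div_of_nonneg_right (mul_le_mul_of_nonneg_right htt₁ hD') hn.le)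
  have hexp_t₂ : ∀ {D' : ℝ}, 0 ≤ D' → Real.exp (-(t₂ * D' / n)) ≤ Real.exp (-(t * D' / n)) := fun hD' =>
    Real.exp_le_exp.2 (by rw [neg_le_neg_iff]; exact div_le_div_of_nonneg_right (mul_le_mul_of_nonneg_right htt₂ hD') hn.le)
  have hslack1 : Real.exp (t * (2 * r) / n) ≤ e := by
    rw [hedef]; refine Real.exp_le_exp.2 ?_
    rw [div_le_one hn]
    have h1 : t * (2 * r) ≤ 1 * (2 * r) := mul_le_mul_of_nonneg_right ht1 (by positivity)
    linarith
  have hslack3 : Real.exp (t * (2 * r + n + 1) / n) ≤ e ^ 3 := by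
    rw [hedef, ← Real.exp_nat_mul]; refine Real.exp_le_exp.2 ?_
    rw [div_le_iff₀ hn]
    have h1 : t * (2 * r + n + 1) ≤ 1 * (2 * r + n + 1) := mul_le_mul_of_nonneg_right ht1 (by positivity)
    push_cast
    linarith
  -- distance bookkeeping: `dist(z, supp f) ≥ D − |x₀ − z|_∞`
  have hsuppz : ∀ z w, f w ≠ 0 → max (D - supDist x₀ z) 0 ≤ (supDist z w : ℝ) := fun z w hw => by
    refine max_le ?_ (Nat.cast_nonneg _)
    have h1 := hsupp w hw
    have h2 := supDist_triangle x₀ z w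
    have : ((supDist x₀ w : ℕ) : ℝ) ≤ ((supDist x₀ z + supDist z w : ℕ) : ℝ) := by exact_mod_cast h2
    push_cast at this; linarith
  ----------------------------------------------------------------------------------------------------------------
  -- the gauge
  set hg := centredGaugeDir U x₀ (2 * r) i with hhg
  set U' := GaugeField.gaugeAct hg U with hU'
  set ψ : Balaban1983to89.Site P 0 → ℂ := fun z => toC (hg z) * φ z with hψdef
  -- the torus source of the gauge copy (`= h·f` on the deep ball)
  set f' : Balaban1983to89.Site P 0 → ℂ := nOp a' P.eps⁻¹ U' k univ *ᵥ ψ with hf'def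
  have hψeq : nOp a' P.eps⁻¹ U' k univ *ᵥ ψ = f' := rfl
  have hf'z : ∀ z, supDist x₀ z ≤ 2 * r → f' z = toC (hg z) * f z := by
    intro z hz
    have hzΩ : z ∈ Ω := hinΩ z (by omega)
    have hs : ∀ ν, z.shift ν ∈ Ω := fun ν => hinΩ _ ((supDist_shift_le_succ x₀ z ν).trans (by omega))
    have hu : ∀ ν, z.unshift ν ∈ Ω := fun ν => hinΩ _ ((supDist_unshift_le_succ x₀ z ν).trans (by omega))
    exact source_eq_on_ball hk0 hc' ha' hg U hΩ f hzΩ hs hu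
  have hnormψ : ∀ z, ‖ψ z‖ = ‖φ z‖ := fun z => by simp only [hψdef]; rw [norm_mul, norm_toC, one_mul]
  have hnormf' : ∀ z, supDist x₀ z ≤ 2 * r → ‖f' z‖ = ‖f z‖ := fun z hz => by rw [hf'z z hz, norm_mul, norm_toC, one_mul]
  have hcov : ∀ z ν, ‖cfg U' ⟨z, ν⟩ * ψ (z.shift ν) - ψ z‖ = ‖cfg U ⟨z, ν⟩ * φ (z.shift ν) - φ z‖ := fun z ν =>
    norm_covDiff_gaugeAct hg U φ z ν
  set γ : ℝ := ((P.d - 1 : ℕ) : ℝ) * θ with hγdef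
  have hγ0 : 0 ≤ γ := by positivity
  have hγn : γ * n ^ 2 ≤ 1 := gamma_nsq_le_one hθ0 hd1' hsmall
  have hgauge : ∀ z ν, supDist x₀ z ≤ 2 * r → ‖cfg U' ⟨z, ν⟩ - 1‖ ≤ γ * ((min (supDist x₀ z) (supDist x₁ z) : ℕ) : ℝ) := by
    intro z ν hz
    have h1 := dist1_centredGaugeDir_le_min U hθ0 hplaq x₀ hRb i hx₁ z hz ν
    rw [BIJ88Smooth43Axial.dist1_eq_norm_toC_sub_one] at h1
    calc ‖cfg U' ⟨z, ν⟩ - 1‖ = ‖toC (GaugeField.gaugeAct hg U ⟨z, ν⟩) - 1‖ := rfl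
      _ ≤ ((P.d - 1 : ℕ) : ℝ) * ((min (supDist x₀ z) (supDist x₁ z) : ℕ) : ℝ) * θ := h1
      _ = γ * ((min (supDist x₀ z) (supDist x₁ z) : ℕ) : ℝ) := by rw [hγdef]; ring
  -- the axis bonds are trivial
  have haxis : ∀ (z : Balaban1983to89.Site P 0) (μ' : Fin P.d), (∀ ν, ν ≠ i → z ν = x₀ ν) → supDist x₀ z ≤ ρ →
      cfg U' ⟨z, μ'⟩ = 1 := by
    intro z μ' hz hzρ
    have hz2 : supDist x₀ z ≤ 2 * r := by omega
    have h1 := dist1_centredGaugeDir_le U hθ0 hplaq x₀ hRb i z hz2 μ' (n := 0) (fun ν hν => by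
      rw [hz ν hν, sub_self]; exact le_of_eq ((B3TorusRadialSums.cdist_eq_zero_iff _).2 rfl))
    rw [Nat.cast_zero, mul_zero, zero_mul, BIJ88Smooth43Axial.dist1_eq_norm_toC_sub_one] at h1
    exact sub_eq_zero.1 (norm_le_zero_iff.1 h1)
  refine ⟨haxis, ?_⟩
  ----------------------------------------------------------------------------------------------------------------
  -- the local data
  set S : ℝ := c_v * P.spacing k ^ 2 * F * E * e ^ 3 with hSdef
  have hS0 : 0 ≤ S := by positivity
  have hSψ : ∀ z, supDist x₀ z ≤ 2 * r + P.L ^ k + 1 → ‖ψ z‖ ≤ S := by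
    intro z hz
    rw [hnormψ]
    refine (hvalP z f F _ hF (hsuppz z)).trans ?_
    have h2 : Real.exp (-(t₁ * max (D - supDist x₀ z) 0 / n)) ≤ E * e ^ 3 := by
      refine ((hexp_t₁ (le_max_right _ _)).trans (hexpD (le_max_left _ _))).trans ?_
      have hz' : (supDist x₀ z : ℝ) ≤ 2 * r + n + 1 := by
        have : ((supDist x₀ z : ℕ) : ℝ) ≤ ((2 * r + P.L ^ k + 1 : ℕ) : ℝ) := by exact_mod_cast hz
        push_cast at this; rw [hndef]; exact this
      calc Real.exp (-(t * (D - supDist x₀ z) / n)) = E * Real.exp (t * supDist x₀ z / n) := by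
            rw [hEdef, ← Real.exp_add]; congr 1; ring
        _ ≤ E * Real.exp (t * (2 * r + n + 1) / n) := by
            refine mul_le_mul_of_nonneg_left (Real.exp_le_exp.2 ?_) hE0.le
            exact div_le_div_of_nonneg_right (mul_le_mul_of_nonneg_left hz' ht.le) hn.le
        _ ≤ E * e ^ 3 := mul_le_mul_of_nonneg_left hslack3 hE0.le
    calc c_v * P.spacing k ^ 2 * Real.exp (-(t₁ * max (D - ↑(supDist x₀ z)) 0 / n)) * F
        ≤ c_v * P.spacing k ^ 2 * (E * e ^ 3) * F := by gcongr
      _ = S := by rw [hSdef]; ring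
  set Mloc : ℝ := P.eps * (c_d * P.spacing k * F * E * e) with hMlocdef
  have hMloc0 : 0 ≤ Mloc := by positivity
  have hMψ : ∀ z ν, supDist x₀ z ≤ 2 * r → ‖cfg U' ⟨z, ν⟩ * ψ (z.shift ν) - ψ z‖ ≤ Mloc := by
    intro z ν hz
    rw [hcov]
    have h1 := hderP z ν f F _ hF (hsuppz z) (hdeepz z hz)
    have hcovD : ‖covD P.eps⁻¹ (cfg U) φ ⟨z, ν⟩‖ = P.eps⁻¹ * ‖cfg U ⟨z, ν⟩ * φ (z.shift ν) - φ z‖ := by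
      show ‖((P.eps⁻¹ : ℝ) : ℂ) * (cfg U ⟨z, ν⟩ * φ (z.shift ν) - φ z)‖ = _
      rw [norm_mul, Complex.norm_real, Real.norm_of_nonneg (inv_nonneg.2 hε.le)]
    rw [hcovD] at h1
    have h2 : Real.exp (-(t₂ * max (D - supDist x₀ z) 0 / n)) ≤ E * e := by
      refine ((hexp_t₂ (le_max_right _ _)).trans (hexpD (le_max_left _ _))).trans ?_
      have hz' : (supDist x₀ z : ℝ) ≤ 2 * r := by exact_mod_cast hz
      calc Real.exp (-(t * (D - supDist x₀ z) / n)) = E * Real.exp (t * supDist x₀ z / n) := by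
            rw [hEdef, ← Real.exp_add]; congr 1; ring
        _ ≤ E * Real.exp (t * (2 * r) / n) := by
            refine mul_le_mul_of_nonneg_left (Real.exp_le_exp.2 ?_) hE0.le
            exact div_le_div_of_nonneg_right (mul_le_mul_of_nonneg_left hz' ht.le) hn.le
        _ ≤ E * e := mul_le_mul_of_nonneg_left hslack1 hE0.le
    have h3 : ‖cfg U ⟨z, ν⟩ * φ (z.shift ν) - φ z‖ ≤ P.eps * (c_d * P.spacing k * Real.exp (-(t₂ * max (D - ↑(supDist x₀ z)) 0 / n)) * F) := by
      have := mul_le_mul_of_nonneg_left h1 hε.le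
      rwa [← mul_assoc, mul_inv_cancel₀ hε.ne', one_mul] at this
    refine h3.trans ?_
    rw [hMlocdef]
    refine mul_le_mul_of_nonneg_left ?_ hε.le
    calc c_d * P.spacing k * Real.exp (-(t₂ * max (D - ↑(supDist x₀ z)) 0 / n)) * F ≤ c_d * P.spacing k * (E * e) * F := by gcongr
      _ = c_d * P.spacing k * F * E * e := by ring
  set Floc : ℝ := F * E * e with hFlocdef
  have hFloc0 : 0 ≤ Floc := by positivity
  have hFf' : ∀ z, supDist x₀ z ≤ 2 * r → ‖f' z‖ ≤ Floc := by
    intro z hz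
    rw [hnormf' z hz]
    by_cases hfz : f z = 0
    · rw [hfz, norm_zero]; exact hFloc0
    · have h1 : D ≤ 2 * r := by
        have := hsupp z hfz
        have h2 : ((supDist x₀ z : ℕ) : ℝ) ≤ ((2 * r : ℕ) : ℝ) := by exact_mod_cast hz
        push_cast at h2; linarith
      have h2 : 1 ≤ E * e := by
        have h3 : Real.exp (-(t * (2 * r) / n)) ≤ E := hexpD h1
        have h4 : Real.exp (-(t * (2 * r) / n)) * Real.exp (t * (2 * r) / n) = 1 := by
          rw [← Real.exp_add, neg_add_cancel, Real.exp_zero]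
        calc (1 : ℝ) = Real.exp (-(t * (2 * r) / n)) * Real.exp (t * (2 * r) / n) := h4.symm
          _ ≤ E * e := mul_le_mul h3 hslack1 (Real.exp_pos _).le hE0.le
      calc ‖f z‖ ≤ F := hF z
        _ = F * 1 := (mul_one F).symm
        _ ≤ F * (E * e) := mul_le_mul_of_nonneg_left h2 hF0
        _ = Floc := by rw [hFlocdef]; ring
  -- the Hölder envelopes of the difference kernel
  have hPdR : (P.d : ℝ) = ((d + 1 : ℕ) : ℝ) := by rw [hPd]
  set A : ℝ := C_H * P.eps ^ 2 * (ρ : ℝ) ^ α with hAdef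
  have hA0 : 0 ≤ A := by positivity
  have hK1 : ∀ z, |((B1RG242Torus.tower P a 0).G k (x₁.shift μ) z - (B1RG242Torus.tower P a 0).G k x₁ z) -
      ((B1RG242Torus.tower P a 0).G k (x₀.shift μ) z - (B1RG242Torus.tower P a 0).G k x₀ z)| ≤
      A / (max ((min (supDist x₀ z) (supDist x₁ z) : ℕ) : ℝ) 1) ^ ((P.d : ℝ) - 1 + α) := fun z => by
    rw [hAdef, hPdR]; exact hholP.1 μ x₀ x₁ z
  have hK2 : ∀ (ν : Fin P.d) z,
      |(((B1RG242Torus.tower P a 0).G k (x₁.shift μ) (z.shift ν) - (B1RG242Torus.tower P a 0).G k x₁ (z.shift ν)) -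
          ((B1RG242Torus.tower P a 0).G k (x₀.shift μ) (z.shift ν) - (B1RG242Torus.tower P a 0).G k x₀ (z.shift ν))) -
        (((B1RG242Torus.tower P a 0).G k (x₁.shift μ) z - (B1RG242Torus.tower P a 0).G k x₁ z) -
          ((B1RG242Torus.tower P a 0).G k (x₀.shift μ) z - (B1RG242Torus.tower P a 0).G k x₀ z))| ≤
      A / (max ((min (supDist x₀ z) (supDist x₁ z) : ℕ) : ℝ) 1) ^ ((P.d : ℝ) + α) := fun ν z => by
    have h := hholP.2 μ ν x₀ x₁ z
    rw [hAdef, hPdR]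
    refine le_trans (le_of_eq ?_) h
    congr 1; ring
  -- THE LOCAL ESTIMATE
  have hmain := hloc P hPd ha hk1 hkK hr4 hN' x₀ x₁ μ hρr U' ψ f' hψeq hA0 hγ0 hS0 hMloc0 hFloc0 hK1 hK2 hgauge hSψ hMψ hFf'
  -- its left-hand side is the target quantity
  have hLHS : (toC (hg (x₁.shift μ)) * φ (x₁.shift μ) - toC (hg x₁) * φ x₁) - (toC (hg (x₀.shift μ)) * φ (x₀.shift μ) - toC (hg x₀) * φ x₀) =
      (ψ (x₁.shift μ) - ψ x₁) - (ψ (x₀.shift μ) - ψ x₀) := rfl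
  rw [hLHS]
  refine hmain.trans ?_
  ----------------------------------------------------------------------------------------------------------------
  -- the powers
  set Pw : ℝ := (r : ℝ) ^ (1 - α) with hPw
  set Qw : ℝ := ((r : ℝ) + (P.L : ℝ) ^ k) ^ (1 - α) with hQw
  set W : ℝ := (ρ : ℝ) ^ α * n ^ (1 - α) with hWdef
  have h1α : 0 ≤ 1 - α := by linarith
  have hρα : 0 ≤ (ρ : ℝ) ^ α := Real.rpow_nonneg hρ0.le α
  have hnα : 0 < n ^ (1 - α) := Real.rpow_pos_of_pos hn _
  have hW0 : 0 ≤ W := by positivity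
  have hWeq : ((ρ : ℝ) / n) ^ α * n = W := div_rpow_mul_eq hρ0.le hn
  have p1 : Pw ≤ n ^ (1 - α) := Real.rpow_le_rpow hr0.le (by linarith) h1α
  have p2 : Qw ≤ 2 * n ^ (1 - α) := by
    rw [hQw, ← hndef]
    exact rpow_le_mul_rpow (by norm_num) (by positivity) hn.le (by linarith) h1α (by linarith)
  have p3 : (r : ℝ) ^ (-α) ≤ 16 * n ^ (-α) := rpow_neg_le_of_le_mul hr0 hn hr16 hα0 hα1.le
  have p4 : n ^ (-α) * n = n ^ (1 - α) := by
    rw [show (1 : ℝ) - α = -α + 1 by ring, Real.rpow_add hn, Real.rpow_one]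
  have hsp2 : P.spacing k ^ 2 = n ^ 2 * P.eps ^ 2 := by rw [hsp]; ring
  -- the five terms against `W ε² E F`
  have q1 : Floc * A * Pw ≤ (C_H * e) * (W * P.eps ^ 2 * E * F) := by
    calc Floc * A * Pw = (C_H * e) * ((ρ : ℝ) ^ α * Pw) * P.eps ^ 2 * E * F := by rw [hFlocdef, hAdef]; ring
      _ ≤ (C_H * e) * ((ρ : ℝ) ^ α * n ^ (1 - α)) * P.eps ^ 2 * E * F := by gcongr
      _ = (C_H * e) * (W * P.eps ^ 2 * E * F) := by rw [hWdef]; ring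
  have q2 : P.eps⁻¹ ^ 2 * (γ * A * (r * Pw * Mloc)) ≤ (C_H * (c_d * e)) * (W * P.eps ^ 2 * E * F) := by
    have e1 : P.eps⁻¹ ^ 2 * (γ * A * (r * Pw * Mloc)) = (C_H * (c_d * e)) * ((γ * (r * n)) * ((ρ : ℝ) ^ α * Pw)) * P.eps ^ 2 * E * F := by
      rw [hAdef, hMlocdef, hsp]; field_simp
    rw [e1]
    have h1 : γ * (r * n) ≤ 1 := by
      calc γ * (r * n) ≤ γ * (n * n) := by gcongr; linarith
        _ = γ * n ^ 2 := by ring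
        _ ≤ 1 := hγn
    have h2 : (γ * (r * n)) * ((ρ : ℝ) ^ α * Pw) ≤ 1 * ((ρ : ℝ) ^ α * n ^ (1 - α)) :=
      mul_le_mul h1 (mul_le_mul_of_nonneg_left p1 hρα) (by positivity) zero_le_one
    calc (C_H * (c_d * e)) * ((γ * (r * n)) * ((ρ : ℝ) ^ α * Pw)) * P.eps ^ 2 * E * F
        ≤ (C_H * (c_d * e)) * (1 * ((ρ : ℝ) ^ α * n ^ (1 - α))) * P.eps ^ 2 * E * F := by gcongr
      _ = (C_H * (c_d * e)) * (W * P.eps ^ 2 * E * F) := by rw [hWdef]; ring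
  have q3 : P.eps⁻¹ ^ 2 * (γ * A * (Pw * S)) ≤ (C_H * (c_v * e ^ 3)) * (W * P.eps ^ 2 * E * F) := by
    have e1 : P.eps⁻¹ ^ 2 * (γ * A * (Pw * S)) = (C_H * (c_v * e ^ 3)) * ((γ * n ^ 2) * ((ρ : ℝ) ^ α * Pw)) * P.eps ^ 2 * E * F := by
      rw [hAdef, hSdef, hsp2]; field_simp
    rw [e1]
    have h2 : (γ * n ^ 2) * ((ρ : ℝ) ^ α * Pw) ≤ 1 * ((ρ : ℝ) ^ α * n ^ (1 - α)) :=
      mul_le_mul hγn (mul_le_mul_of_nonneg_left p1 hρα) (by positivity) zero_le_one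
    calc (C_H * (c_v * e ^ 3)) * ((γ * n ^ 2) * ((ρ : ℝ) ^ α * Pw)) * P.eps ^ 2 * E * F
        ≤ (C_H * (c_v * e ^ 3)) * (1 * ((ρ : ℝ) ^ α * n ^ (1 - α))) * P.eps ^ 2 * E * F := by gcongr
      _ = (C_H * (c_v * e ^ 3)) * (W * P.eps ^ 2 * E * F) := by rw [hWdef]; ring
  have q4 : P.eps⁻¹ ^ 2 * (A * S * ((r : ℝ) ^ (-α) / r)) ≤ (C_H * (256 * c_v * e ^ 3)) * (W * P.eps ^ 2 * E * F) := by
    have e1 : P.eps⁻¹ ^ 2 * (A * S * ((r : ℝ) ^ (-α) / r)) =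
        (C_H * (c_v * e ^ 3)) * ((ρ : ℝ) ^ α * ((r : ℝ) ^ (-α) * (n ^ 2 / r))) * P.eps ^ 2 * E * F := by
      rw [hAdef, hSdef, hsp2]; field_simp
    rw [e1]
    have h1 : n ^ 2 / r ≤ 16 * n := by
      rw [div_le_iff₀ hr0]
      calc n ^ 2 = n * n := sq n
        _ ≤ n * (16 * r) := mul_le_mul_of_nonneg_left hr16 hn.le
        _ = 16 * n * r := by ring
    have h2 : (r : ℝ) ^ (-α) * (n ^ 2 / r) ≤ (16 * n ^ (-α)) * (16 * n) :=
      mul_le_mul p3 h1 (by positivity) (by positivity)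
    have h3 : (ρ : ℝ) ^ α * ((r : ℝ) ^ (-α) * (n ^ 2 / r)) ≤ 256 * ((ρ : ℝ) ^ α * n ^ (1 - α)) := by
      calc (ρ : ℝ) ^ α * ((r : ℝ) ^ (-α) * (n ^ 2 / r)) ≤ (ρ : ℝ) ^ α * ((16 * n ^ (-α)) * (16 * n)) :=
            mul_le_mul_of_nonneg_left h2 hρα
        _ = 256 * ((ρ : ℝ) ^ α * (n ^ (-α) * n)) := by ring
        _ = 256 * ((ρ : ℝ) ^ α * n ^ (1 - α)) := by rw [p4]
    calc (C_H * (c_v * e ^ 3)) * ((ρ : ℝ) ^ α * ((r : ℝ) ^ (-α) * (n ^ 2 / r))) * P.eps ^ 2 * E * F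
        ≤ (C_H * (c_v * e ^ 3)) * (256 * ((ρ : ℝ) ^ α * n ^ (1 - α))) * P.eps ^ 2 * E * F := by gcongr
      _ = (C_H * (256 * c_v * e ^ 3)) * (W * P.eps ^ 2 * E * F) := by rw [hWdef]; ring
  have q5 : B1RG242Torus.α P a k * A * Qw * S ≤ (C_H * (2 * a * c_v * e ^ 3)) * (W * P.eps ^ 2 * E * F) := by
    have e1 : B1RG242Torus.α P a k * A * Qw * S =
        (C_H * (c_v * e ^ 3)) * ((B1RG242Torus.α P a k * P.spacing k ^ 2) * ((ρ : ℝ) ^ α * Qw)) * P.eps ^ 2 * E * F := by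
      rw [hAdef, hSdef]; ring
    rw [e1]
    have h2 : (B1RG242Torus.α P a k * P.spacing k ^ 2) * ((ρ : ℝ) ^ α * Qw) ≤ a * (2 * ((ρ : ℝ) ^ α * n ^ (1 - α))) := by
      refine mul_le_mul hαa ?_ (by positivity) ha.le
      calc (ρ : ℝ) ^ α * Qw ≤ (ρ : ℝ) ^ α * (2 * n ^ (1 - α)) := mul_le_mul_of_nonneg_left p2 hρα
        _ = _ := by ring
    calc (C_H * (c_v * e ^ 3)) * ((B1RG242Torus.α P a k * P.spacing k ^ 2) * ((ρ : ℝ) ^ α * Qw)) * P.eps ^ 2 * E * F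
        ≤ (C_H * (c_v * e ^ 3)) * (a * (2 * ((ρ : ℝ) ^ α * n ^ (1 - α)))) * P.eps ^ 2 * E * F := by gcongr
      _ = (C_H * (2 * a * c_v * e ^ 3)) * (W * P.eps ^ 2 * E * F) := by rw [hWdef]; ring
  have hsum : Floc * A * Pw + P.eps⁻¹ ^ 2 * (γ * A * (r * Pw * Mloc + Pw * S) + A * S * ((r : ℝ) ^ (-α) / r)) +
      B1RG242Torus.α P a k * A * Qw * S ≤
      (C_H * (e + c_d * e + c_v * e ^ 3 + 256 * c_v * e ^ 3 + 2 * a * c_v * e ^ 3)) * (W * P.eps ^ 2 * E * F) := by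
    have e1 : P.eps⁻¹ ^ 2 * (γ * A * (r * Pw * Mloc + Pw * S) + A * S * ((r : ℝ) ^ (-α) / r)) =
        P.eps⁻¹ ^ 2 * (γ * A * (r * Pw * Mloc)) + P.eps⁻¹ ^ 2 * (γ * A * (Pw * S)) + P.eps⁻¹ ^ 2 * (A * S * ((r : ℝ) ^ (-α) / r)) := by
      ring
    rw [e1]
    linarith only [q1, q2, q3, q4, q5]
  have hWε : W * P.eps ^ 2 * E * F = ((ρ : ℝ) / n) ^ α * P.spacing k * P.eps * E * F := by
    rw [← hWeq, hsp]; ring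
  have hfin : C_L * ((C_H * (e + c_d * e + c_v * e ^ 3 + 256 * c_v * e ^ 3 + 2 * a * c_v * e ^ 3)) * (W * P.eps ^ 2 * E * F)) =
      K₁ * (((ρ : ℝ) / n) ^ α * P.spacing k * P.eps * E * F) := by rw [hWε, hK₁]; ring
  have hunit : 0 ≤ ((ρ : ℝ) / n) ^ α * P.spacing k * P.eps * E * F := by positivity
  calc C_L * (Floc * A * Pw + P.eps⁻¹ ^ 2 * (γ * A * (r * Pw * Mloc + Pw * S) + A * S * ((r : ℝ) ^ (-α) / r)) +
        B1RG242Torus.α P a k * A * Qw * S)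
      ≤ C_L * ((C_H * (e + c_d * e + c_v * e ^ 3 + 256 * c_v * e ^ 3 + 2 * a * c_v * e ^ 3)) * (W * P.eps ^ 2 * E * F)) :=
        mul_le_mul_of_nonneg_left hsum hCL.le
    _ = K₁ * (((ρ : ℝ) / n) ^ α * P.spacing k * P.eps * E * F) := hfin
    _ ≤ (K₁ + 1) * (((ρ : ℝ) / n) ^ α * P.spacing k * P.eps * E * F) := by nlinarith only [hunit]
    _ = (K₁ + 1) * ((supDist x₀ x₁ : ℝ) / (P.L : ℝ) ^ k) ^ α * P.spacing k * P.eps * Real.exp (-(t * D / (P.L : ℝ) ^ k)) * F := by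
        rw [hρdef, hEdef, hndef]; ring

end LegGauged

/-! ## §2 The gauge-invariant Hölder estimate at an axis-parallel deep pair of a `k`-block union -/

section Leg

variable {d : ℕ}

/-- **THE HÖLDER MEMBER OF [6] (1.9) FOR THE REGION PROPAGATOR AT AN AXIS-PARALLEL DEEP PAIR, GAUGE-INVARIANT FORM** — for p31's region
propagator of record `G_k(Ω,u) = gBox (α_kL^{kd}) ε⁻¹ u k Ω` on an arbitrary `k`-block union `Ω`, under p34's region hypotheses (plaquettes
within `θ`, `2(d+1)³(L^{2k}θ)² ≤ 1`; bondwise `(T, δ)` on `Ω`): for `1 ≤ d`, `d+1 ≤ 3`, `L` odd `> 1`, `a > 0`, `0 ≤ α < 1` there are `t₀, c₀ > 0`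
such that, `k`-uniformly, for every `k`-block union, every site `x` with `dist_∞(x, T∖Ω) ≥ 2L^k`, directions `i, μ`, every `1 ≤ ρ ≤ L^k/64` and
every `f` with `|f| ≤ F` vanishing at sup-distance `< D` from `x`, with `x′ = x + ρe_i` and `Γ = [x, x′]` the straight segment:
`‖U(Γ)·(D_uG_k(Ω,u)f)(⟨x′, μ⟩) − (D_uG_k(Ω,u)f)(⟨x, μ⟩)‖ ≤ c₀(ρ/L^k)^α(L^kε)e^{−t₀D/L^k}F`.  Proof: §1 (in the axis-rooted gauge the transport is
`1` and the covariant derivatives are plain differences) and gauge covariance (p30's `axisHol_gaugeAct`, `covD_gaugeAct`) — p27's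
`holder19_cube_leg` proof verbatim.
[cite: Balaban1983RegularityDecay, Theorem p.573 (1.9)] [cite: BalabanImbrieJaffe1988, p.263] [cite: BalabanImbrieJaffe1985, (2.7) p.303, (7.3.1) p.326] -/
theorem holder19_region_leg (d L : ℕ) (hd1 : 1 ≤ d) (hd3 : d + 1 ≤ 3) (hL : Odd L ∧ 1 < L) {a : ℝ} (ha : 0 < a) {α : ℝ} (hα0 : 0 ≤ α)
    (hα1 : α < 1) :
    ∃ t₀ c₀ : ℝ, 0 < t₀ ∧ 0 < c₀ ∧ ∀ (P : Params), P.d = d + 1 → P.L = L →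
      ∀ k : ℕ, 1 ≤ k → k ≤ P.K → ∀ Ω : Finset (Balaban1983to89.Site P 0), IsBlockUnion k Ω →
        ∀ (U : GaugeField P 0 U1) (θ T δ : ℝ), 0 ≤ θ →
          (∀ p : Balaban1983to89.Plaq P 0, ‖toC (plaqHol U p) - 1‖ ≤ θ) →
          2 * (P.d : ℝ) ^ 3 * (((P.L : ℝ) ^ k) ^ 2 * θ) ^ 2 ≤ 1 →
          (∀ b ∈ starB Ω, blkIter k b.src = blkIter k b.tgt → ‖toC (U b) - 1‖ ≤ T) →
          (∀ y ∈ Ω, ‖holCK U k y - 1‖ ≤ δ) →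
          2 * (((P.L : ℝ) ^ k - 1) * (P.L : ℝ) ^ k) * P.d * T ^ 2 + 2 * δ ^ 2 ≤ 1 / 2 →
        ∀ (x : Balaban1983to89.Site P 0) (i μ : Fin P.d) (ρ : ℕ), 1 ≤ ρ → 64 * ρ ≤ P.L ^ k →
          (∀ w, w ∉ Ω → 2 * P.L ^ k ≤ supDist x w) →
        ∀ (f : Balaban1983to89.Site P 0 → ℂ) (F D : ℝ),
          (∀ z, ‖f z‖ ≤ F) → (∀ z, f z ≠ 0 → D ≤ (supDist x z : ℝ)) →
          ‖toC (axisHol U i ρ x) *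
                covD P.eps⁻¹ (cfg U) (gBox (B1RG242Torus.α P a k * (P.L : ℝ) ^ (k * P.d)) P.eps⁻¹ U k Ω *ᵥ f) ⟨runSite x i ρ, μ⟩ -
              covD P.eps⁻¹ (cfg U) (gBox (B1RG242Torus.α P a k * (P.L : ℝ) ^ (k * P.d)) P.eps⁻¹ U k Ω *ᵥ f) ⟨x, μ⟩‖
            ≤ c₀ * ((ρ : ℝ) / (P.L : ℝ) ^ k) ^ α * P.spacing k * Real.exp (-(t₀ * D / (P.L : ℝ) ^ k)) * F := by
  obtain ⟨t₀, c₀, ht₀, hc₀, hleg⟩ := holder19_region_leg_gauged d L hd1 hd3 hL ha hα0 hα1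
  refine ⟨t₀, c₀, ht₀, hc₀, ?_⟩
  intro P hPd hPL k hk1 hkK Ω hΩ U θ T δ hθ0 hθ hsmall hInt hTree hsmallT x i μ ρ hρ1 hρ64 hdeep f F D hF hsupp
  have hk : k ≤ P.m + P.K := hkK.trans (Nat.le_add_left _ _)
  have hNN : 2 * P.L ^ k ≤ P.sitesPerDir 0 := BIJ85ScalarPropagatorSupDecayDeriv.two_mul_pow_le_sitesPerDir hk
  set x₁ := runSite x i ρ with hx₁
  have hax : ∀ ν, ν ≠ i → x₁ ν = x ν := fun ν hν => runSite_apply_ne x hν ρ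
  have hdist : supDist x x₁ = ρ := supDist_runSite_eq x i (by omega)
  have h1 : 1 ≤ supDist x x₁ := by rw [hdist]; exact hρ1
  have h64 : 64 * supDist x x₁ ≤ P.L ^ k := by rw [hdist]; exact hρ64
  obtain ⟨haxis, hest⟩ :=
    hleg P hPd hPL k hk1 hkK Ω hΩ U θ T δ hθ0 hθ hsmall hInt hTree hsmallT x x₁ i μ hax h1 h64 hdeep f F D hF hsupp
  rw [hdist] at hest
  set hg := BIJ85BiCentredAxialGauge.centredGaugeDir U x (2 * (P.L ^ k / 8)) i with hhg
  set φ := gBox (B1RG242Torus.α P a k * (P.L : ℝ) ^ (k * P.d)) P.eps⁻¹ U k Ω *ᵥ f with hφ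
  set U' := gaugeAct hg U with hU'
  set ψ : Balaban1983to89.Site P 0 → ℂ := fun z => toC (hg z) * φ z with hψ
  -- the transport and the two bond variables are trivial in the gauge
  have hseg : ∀ s, s < ρ → cfg U' ⟨runSite x i s, i⟩ = 1 := fun s hs =>
    haxis (runSite x i s) i (fun ν hν => runSite_apply_ne x hν s) (by rw [hdist]; exact (supDist_runSite_le x i s).trans hs.le)
  have hA' : toC (axisHol U' i ρ x) = 1 := toC_axisHol_eq_one U' i ρ x hseg
  have hu0 : cfg U' ⟨x, μ⟩ = 1 := haxis x μ (fun _ _ => rfl) (by rw [(supDist_eq_zero_iff x x).2 rfl]; exact Nat.zero_le _)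
  have hu1 : cfg U' ⟨x₁, μ⟩ = 1 := haxis x₁ μ hax le_rfl
  -- gauge covariance of the three factors
  have hAg : toC (axisHol U' i ρ x) = toC (hg x) * toC (axisHol U i ρ x) * conj (toC (hg x₁)) := by
    rw [hU', axisHol_gaugeAct, toC_mul, toC_mul, toC_inv]
  have hD0 : covD P.eps⁻¹ (cfg U') ψ ⟨x, μ⟩ = toC (hg x) * covD P.eps⁻¹ (cfg U) φ ⟨x, μ⟩ := covD_gaugeAct _ hg U φ _
  have hD1 : covD P.eps⁻¹ (cfg U') ψ ⟨x₁, μ⟩ = toC (hg x₁) * covD P.eps⁻¹ (cfg U) φ ⟨x₁, μ⟩ := covD_gaugeAct _ hg U φ _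
  -- the invariant quantity in the gauge
  have hkey : toC (hg x) * (toC (axisHol U i ρ x) * covD P.eps⁻¹ (cfg U) φ ⟨x₁, μ⟩ - covD P.eps⁻¹ (cfg U) φ ⟨x, μ⟩) =
      toC (axisHol U' i ρ x) * covD P.eps⁻¹ (cfg U') ψ ⟨x₁, μ⟩ - covD P.eps⁻¹ (cfg U') ψ ⟨x, μ⟩ := by
    rw [hAg, hD0, hD1]
    have h1 : conj (toC (hg x₁)) * toC (hg x₁) = 1 := conj_mul_toC _
    linear_combination (-(toC (hg x) * toC (axisHol U i ρ x) * covD P.eps⁻¹ (cfg U) φ ⟨x₁, μ⟩)) * h1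
  -- in the gauge: plain second difference divided by `ε`
  have hgauged : toC (axisHol U' i ρ x) * covD P.eps⁻¹ (cfg U') ψ ⟨x₁, μ⟩ - covD P.eps⁻¹ (cfg U') ψ ⟨x, μ⟩ =
      ((P.eps⁻¹ : ℝ) : ℂ) * ((ψ (x₁.shift μ) - ψ x₁) - (ψ (x.shift μ) - ψ x)) := by
    rw [hA', one_mul]
    simp only [covD, hu0, hu1, one_mul]
    show ((P.eps⁻¹ : ℝ) : ℂ) * (ψ (x₁.shift μ) - ψ x₁) - ((P.eps⁻¹ : ℝ) : ℂ) * (ψ (x.shift μ) - ψ x) = _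
    ring
  have hnorm : ‖toC (axisHol U i ρ x) * covD P.eps⁻¹ (cfg U) φ ⟨x₁, μ⟩ - covD P.eps⁻¹ (cfg U) φ ⟨x, μ⟩‖ =
      P.eps⁻¹ * ‖(ψ (x₁.shift μ) - ψ x₁) - (ψ (x.shift μ) - ψ x)‖ := by
    have h1 : ‖toC (hg x) * (toC (axisHol U i ρ x) * covD P.eps⁻¹ (cfg U) φ ⟨x₁, μ⟩ - covD P.eps⁻¹ (cfg U) φ ⟨x, μ⟩)‖ =
        ‖toC (axisHol U i ρ x) * covD P.eps⁻¹ (cfg U) φ ⟨x₁, μ⟩ - covD P.eps⁻¹ (cfg U) φ ⟨x, μ⟩‖ := by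
      rw [norm_mul, norm_toC, one_mul]
    rw [← h1, hkey, hgauged, norm_mul, Complex.norm_real, Real.norm_of_nonneg (inv_nonneg.2 P.eps_pos.le)]
  rw [hnorm]
  have hε : 0 < P.eps := P.eps_pos
  calc P.eps⁻¹ * ‖(ψ (x₁.shift μ) - ψ x₁) - (ψ (x.shift μ) - ψ x)‖
      ≤ P.eps⁻¹ * (c₀ * ((ρ : ℝ) / (P.L : ℝ) ^ k) ^ α * P.spacing k * P.eps * Real.exp (-(t₀ * D / (P.L : ℝ) ^ k)) * F) :=
        mul_le_mul_of_nonneg_left hest (inv_nonneg.2 hε.le)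
    _ = c₀ * ((ρ : ℝ) / (P.L : ℝ) ^ k) ^ α * P.spacing k * Real.exp (-(t₀ * D / (P.L : ℝ) ^ k)) * F := by field_simp

end Leg

/-! ## §3 [6] (1.9) for the region propagators `G_k(Ω,u)` at small non-flat fields — ALL DEEP PAIRS, `k`-uniform -/

section Main

variable {d : ℕ}

set_option maxHeartbeats 400000 in
/-- **THE HÖLDER MEMBER OF [Balaban1983RegularityDecay] (1.9) FOR THE COVARIANT DERIVATIVE OF THE REGION NEUMANN PROPAGATOR `G_k(Ω,u)` ON A
GENERAL `k`-BLOCK UNION AT SMALL NON-FLAT FIELDS, `k`-UNIFORM, ALL DEEP PAIRS** — for [BalabanImbrieJaffe1988] p. 263 *"Bounds analogous to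
(2.30), (2.31) hold for covariant derivatives and Hölder derivatives of G_{k,loc}(u) of order less than two"*, [BalabanImbrieJaffe1985] p. 326
*"The propagators arising from Δ_k(u_k), under the restriction (7.3.1) on the gauge field, also satisfy the regularity and decay estimates of
[7]"* and (1.9) *"|x−x′|^{−α}|U(A(Γ_{x,x′}))(D^η_{A,μ}G_k(Ω,A)f)(x′) − (D^η_{A,μ}G_k(Ω,A)f)(x)| ≤ c₀exp(−δ₀dist({x,x′},supp f))‖f‖_∞ … for
x, x′ ∈ Ω, and satisfying the condition dist({x,x′},Ω^c) ≧ R₀"*, for p31's REGION propagator of record `G_k(Ω,u) = gBox (α_kL^{kd}) ε⁻¹ u k Ω`,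
`Ω` ANY union of `k`-blocks of the fine torus, under p34's region hypotheses (plaquettes within `θ`, `2(d+1)³(L^{2k}θ)² ≤ 1`; bondwise `(T, δ)`
on `Ω`): for `1 ≤ d`, `d+1 ≤ 3`, `L` odd `> 1`, `a > 0`, `0 ≤ α < 1` there are `t₀, c₀ > 0` (on `d, L, a, α`) such that for every volume, every
`1 ≤ k ≤ K`, every `k`-block union `Ω`, every such field, every pair of distinct sites `x₀, x₁` BOTH `3L^k`-DEEP in `Ω` (here [6]'s `R₀` = three
units of the `L^{−k}`-lattice), every direction `μ` and every `f` with `|f| ≤ F` vanishing at sup-distance `< D` from the pair `{x₀, x₁}`: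
`(L^k/|x₀−x₁|_∞)^α·‖U(Γ_{x₀,x₁})(D_uG_k(Ω,u)f)(⟨x₁,μ⟩) − (D_uG_k(Ω,u)f)(⟨x₀,μ⟩)‖ ≤ c₀(L^kε)e^{−t₀D/L^k}F`, `Γ_{x₀,x₁}` p30's shortest staircase
contour (`stairHol`) — ONE power of the block spacing as in the `D_u` member.  Near pairs (`64|x₀−x₁|_∞ ≤ L^k`): `d+1` axis-parallel legs (§2;
every corner is within `|x₀−x₁|_∞ ≤ L^k/64` of `x₀`, hence `2L^k`-deep) telescoped (`stair_telescope`); far pairs: p34's region `D_u` member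
`decay110_smallField_region_deriv` at both bonds (both `L^k`-deep) — p27's `holder19_smallField_cube` proof verbatim.
[cite: Balaban1983RegularityDecay, Theorem p.573 (1.9)] [cite: BalabanImbrieJaffe1988, (2.30) p.263] [cite: BalabanImbrieJaffe1985, (7.3.1) p.326] -/
theorem holder19_smallField_region (d L : ℕ) (hd1 : 1 ≤ d) (hd3 : d + 1 ≤ 3) (hL : Odd L ∧ 1 < L) {a : ℝ} (ha : 0 < a) {α : ℝ}
    (hα0 : 0 ≤ α) (hα1 : α < 1) :
    ∃ t₀ c₀ : ℝ, 0 < t₀ ∧ 0 < c₀ ∧ ∀ (P : Params), P.d = d + 1 → P.L = L →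
      ∀ k : ℕ, 1 ≤ k → k ≤ P.K → ∀ Ω : Finset (Balaban1983to89.Site P 0), IsBlockUnion k Ω →
        ∀ (U : GaugeField P 0 U1) (θ T δ : ℝ), 0 ≤ θ →
          (∀ p : Balaban1983to89.Plaq P 0, ‖toC (plaqHol U p) - 1‖ ≤ θ) →
          2 * (P.d : ℝ) ^ 3 * (((P.L : ℝ) ^ k) ^ 2 * θ) ^ 2 ≤ 1 →
          (∀ b ∈ starB Ω, blkIter k b.src = blkIter k b.tgt → ‖toC (U b) - 1‖ ≤ T) →
          (∀ y ∈ Ω, ‖holCK U k y - 1‖ ≤ δ) →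
          2 * (((P.L : ℝ) ^ k - 1) * (P.L : ℝ) ^ k) * P.d * T ^ 2 + 2 * δ ^ 2 ≤ 1 / 2 →
        ∀ (x₀ x₁ : Balaban1983to89.Site P 0) (μ : Fin P.d), x₀ ≠ x₁ →
          (∀ w, w ∉ Ω → 3 * P.L ^ k ≤ supDist x₀ w) →
          (∀ w, w ∉ Ω → 3 * P.L ^ k ≤ supDist x₁ w) →
        ∀ (f : Balaban1983to89.Site P 0 → ℂ) (F D : ℝ),
          (∀ z, ‖f z‖ ≤ F) → (∀ z, f z ≠ 0 → D ≤ (supDist x₀ z : ℝ) ∧ D ≤ (supDist x₁ z : ℝ)) →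
          (((P.L : ℝ) ^ k / (supDist x₀ x₁ : ℝ)) ^ α *
            ‖stairHol U x₀ x₁ *
                covD P.eps⁻¹ (cfg U) (gBox (B1RG242Torus.α P a k * (P.L : ℝ) ^ (k * P.d)) P.eps⁻¹ U k Ω *ᵥ f) ⟨x₁, μ⟩ -
              covD P.eps⁻¹ (cfg U) (gBox (B1RG242Torus.α P a k * (P.L : ℝ) ^ (k * P.d)) P.eps⁻¹ U k Ω *ᵥ f) ⟨x₀, μ⟩‖
            ≤ c₀ * P.spacing k * Real.exp (-(t₀ * D / (P.L : ℝ) ^ k)) * F) := by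
  classical
  obtain ⟨t₁, c₁, ht₁, hc₁, hleg⟩ := holder19_region_leg d L hd1 hd3 hL ha hα0 hα1
  obtain ⟨t₂, c₂, ht₂, hc₂, hder⟩ := decay110_smallField_region_deriv d L hd1 hd3 hL ha
  set t : ℝ := min t₁ t₂ with htdef
  have ht : 0 < t := lt_min ht₁ ht₂
  have htt₁ : t ≤ t₁ := min_le_left _ _
  have htt₂ : t ≤ t₂ := min_le_right _ _
  set K : ℝ := ((d + 1 : ℕ) : ℝ) * (c₁ * Real.exp t₁) + 128 * c₂ with hKdef
  refine ⟨t, K + 1, ht, by positivity, ?_⟩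
  intro P hPd hPL k hk1 hkK Ω hΩ U θ T δ hθ0 hθ hsmall hInt hTree hsmallT x₀ x₁ μ hne hdeep₀ hdeep₁ f F D hF hsupp
  have hlegP := hleg P hPd hPL k hk1 hkK Ω hΩ U θ T δ hθ0 hθ hsmall hInt hTree hsmallT
  have hderP := hder P hPd hPL k hk1 hkK Ω hΩ U θ T δ hθ0 hθ hsmall hInt hTree hsmallT
  have hPdR : (P.d : ℝ) = ((d + 1 : ℕ) : ℝ) := by rw [hPd]
  -- basic quantities
  have hLpos : (0 : ℝ) < P.L := P.cast_L_pos
  set n : ℝ := (P.L : ℝ) ^ k with hndef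
  have hn : 0 < n := pow_pos hLpos k
  have hnnat : ((P.L ^ k : ℕ) : ℝ) = n := by push_cast; rw [hndef]
  have hsp0 : 0 < P.spacing k := P.spacing_pos k
  have hε : 0 < P.eps := P.eps_pos
  have hF0 : 0 ≤ F := (norm_nonneg _).trans (hF x₀)
  have hLk1 : 1 ≤ P.L ^ k := Nat.one_le_pow _ _ P.L_pos
  set ρ : ℕ := supDist x₀ x₁ with hρdef
  have hρ1 : 1 ≤ ρ := by
    by_contra h
    push Not at h
    exact hne ((supDist_eq_zero_iff x₀ x₁).1 (by omega))
  have hρ0 : (0 : ℝ) < ρ := by exact_mod_cast hρ1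
  -- the end points are `L^k`-deep (for the far `D_u` members)
  have hdx₀ : ∀ w, w ∉ Ω → P.L ^ k ≤ supDist x₀ w := fun w hw => le_trans (by omega) (hdeep₀ w hw)
  have hdx₁ : ∀ w, w ∉ Ω → P.L ^ k ≤ supDist x₁ w := fun w hw => le_trans (by omega) (hdeep₁ w hw)
  set φ := gBox (B1RG242Torus.α P a k * (P.L : ℝ) ^ (k * P.d)) P.eps⁻¹ U k Ω *ᵥ f with hφ
  set X : Balaban1983to89.Site P 0 → ℂ := fun w => covD P.eps⁻¹ (cfg U) φ ⟨w, μ⟩ with hX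
  set E : ℝ := Real.exp (-(t * D / n)) with hEdef
  have hE0 : 0 < E := Real.exp_pos _
  have hexp_t : ∀ {s D' : ℝ}, t ≤ s → D ≤ D' → 0 ≤ D' → Real.exp (-(s * D' / n)) ≤ E := by
    intro s D' hs hD hD'
    rw [hEdef]; refine Real.exp_le_exp.2 ?_
    rw [neg_le_neg_iff]
    exact div_le_div_of_nonneg_right ((mul_le_mul_of_nonneg_left hD ht.le).trans (mul_le_mul_of_nonneg_right hs hD')) hn.le
  -- the unit `W = (ρ/n)^α`
  set W : ℝ := ((ρ : ℝ) / n) ^ α with hWdef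
  have hW0 : 0 < W := Real.rpow_pos_of_pos (div_pos hρ0 hn) α
  have hWinv : (n / (ρ : ℝ)) ^ α * W = 1 := by
    rw [hWdef, ← Real.mul_rpow (by positivity) (by positivity), div_mul_div_comm, mul_comm n, div_self (by positivity), Real.one_rpow]
  have hK0 : 0 ≤ K := by positivity
  -- it suffices to bound the norm by `K·W·sp·E·F`
  suffices hmain : ‖stairHol U x₀ x₁ * X x₁ - X x₀‖ ≤ K * W * P.spacing k * E * F by
    have h1 : (n / (ρ : ℝ)) ^ α * ‖stairHol U x₀ x₁ * X x₁ - X x₀‖ ≤ (n / (ρ : ℝ)) ^ α * (K * W * P.spacing k * E * F) :=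
      mul_le_mul_of_nonneg_left hmain (Real.rpow_nonneg (by positivity) α)
    have h2 : (n / (ρ : ℝ)) ^ α * (K * W * P.spacing k * E * F) = K * P.spacing k * E * F := by
      calc (n / (ρ : ℝ)) ^ α * (K * W * P.spacing k * E * F) = ((n / (ρ : ℝ)) ^ α * W) * (K * P.spacing k * E * F) := by ring
        _ = K * P.spacing k * E * F := by rw [hWinv, one_mul]
    have h3 : K * P.spacing k * E * F ≤ (K + 1) * P.spacing k * E * F := by
      have : 0 ≤ P.spacing k * E * F := by positivity
      nlinarith
    simpa [hX, hρdef, hEdef, hndef] using (h1.trans (h2.le.trans h3))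
  by_cases hfar : P.L ^ k < 64 * ρ
  · ----------------------------------------------------------------------------------------------------------------
    -- FAR PAIRS: the `D_u` member at both bonds
    have hX0 : ‖X x₀‖ ≤ c₂ * P.spacing k * E * F := by
      have h := hderP x₀ μ f F (max D 0) hF (fun z hz => max_le (hsupp z hz).1 (Nat.cast_nonneg _)) hdx₀
      refine h.trans ?_
      have : Real.exp (-(t₂ * max D 0 / n)) ≤ E := hexp_t htt₂ (le_max_left _ _) (le_max_right _ _)
      gcongr
    have hX1 : ‖X x₁‖ ≤ c₂ * P.spacing k * E * F := by
      have h := hderP x₁ μ f F (max D 0) hF (fun z hz => max_le (hsupp z hz).2 (Nat.cast_nonneg _)) hdx₁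
      refine h.trans ?_
      have : Real.exp (-(t₂ * max D 0 / n)) ≤ E := hexp_t htt₂ (le_max_left _ _) (le_max_right _ _)
      gcongr
    have hW64 : 1 ≤ 64 * W := by
      have h1 : (1 : ℝ) / 64 ≤ (ρ : ℝ) / n := by
        rw [div_le_div_iff₀ (by norm_num) hn]
        have : ((P.L ^ k : ℕ) : ℝ) ≤ ((64 * ρ : ℕ) : ℝ) := by exact_mod_cast hfar.le
        rw [hnnat] at this; push_cast at this; linarith
      have h2 : ((1 : ℝ) / 64) ^ α ≤ W := Real.rpow_le_rpow (by norm_num) h1 hα0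
      have h3 : (1 : ℝ) / 64 ≤ ((1 : ℝ) / 64) ^ α := by
        have := Real.rpow_le_rpow_of_exponent_ge (by norm_num : (0 : ℝ) < 1 / 64) (by norm_num : (1 : ℝ) / 64 ≤ 1) hα1.le
        rwa [Real.rpow_one] at this
      linarith
    calc ‖stairHol U x₀ x₁ * X x₁ - X x₀‖ ≤ ‖stairHol U x₀ x₁ * X x₁‖ + ‖X x₀‖ := norm_sub_le _ _
      _ = ‖X x₁‖ + ‖X x₀‖ := by rw [norm_mul, norm_stairHol, one_mul]
      _ ≤ 2 * (c₂ * P.spacing k * E * F) := by linarith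
      _ ≤ 2 * (c₂ * P.spacing k * E * F) * (64 * W) := le_mul_of_one_le_right (by positivity) hW64
      _ = (128 * c₂) * W * P.spacing k * E * F := by ring
      _ ≤ K * W * P.spacing k * E * F := by
          have : 128 * c₂ ≤ K := by rw [hKdef]; linarith [show 0 ≤ ((d + 1 : ℕ) : ℝ) * (c₁ * Real.exp t₁) by positivity]
          gcongr
  ----------------------------------------------------------------------------------------------------------------
  -- NEAR PAIRS: the staircase
  push Not at hfar
  have hρn : 64 * (ρ : ℝ) ≤ n := by rw [← hnnat]; exact_mod_cast hfar
  -- every corner within `ρ` of `x₀` is `2L^k`-deep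
  have hdeepw : ∀ w₀ : Balaban1983to89.Site P 0, supDist x₀ w₀ ≤ ρ → ∀ u, u ∉ Ω → 2 * P.L ^ k ≤ supDist w₀ u := by
    intro w₀ hw₀ u hu
    have h1 := hdeep₀ u hu
    have h2 := supDist_triangle x₀ w₀ u
    omega
  -- the per-leg bound
  have hlegB : ∀ l, l < P.d → ‖legHol U x₀ x₁ l * X (stairPt x₀ x₁ (l + 1)) - X (stairPt x₀ x₁ l)‖ ≤
      (c₁ * Real.exp t₁) * W * P.spacing k * E * F := by
    intro l hl
    set m : Fin P.d := ⟨l, hl⟩ with hm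
    set w := stairPt x₀ x₁ l with hw
    set w' := stairPt x₀ x₁ (l + 1) with hw'
    set sf : ℕ := (x₁ m - x₀ m).val with hsf
    set sb : ℕ := (x₀ m - x₁ m).val with hsb
    have hmin : min sf sb ≤ ρ := min_val_le_supDist x₀ x₁ m
    -- distances from the corners to the support
    have hsuppw : ∀ w₀ : Balaban1983to89.Site P 0, supDist x₀ w₀ ≤ ρ → ∀ z, f z ≠ 0 → max (D - ρ) 0 ≤ (supDist w₀ z : ℝ) := by
      intro w₀ hw₀ z hz
      refine max_le ?_ (Nat.cast_nonneg _)
      have h1 := (hsupp z hz).1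
      have h2 := supDist_triangle x₀ w₀ z
      have h3 : ((supDist x₀ z : ℕ) : ℝ) ≤ ((supDist x₀ w₀ + supDist w₀ z : ℕ) : ℝ) := by exact_mod_cast h2
      have h4 : ((supDist x₀ w₀ : ℕ) : ℝ) ≤ ρ := by exact_mod_cast hw₀
      push_cast at h3; linarith
    have hEρ : Real.exp (-(t₁ * max (D - ρ) 0 / n)) ≤ Real.exp t₁ * E := by
      rw [hEdef, ← Real.exp_add]
      refine Real.exp_le_exp.2 ?_
      have hD'' : 0 ≤ max (D - (ρ : ℝ)) 0 := le_max_right _ _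
      have h1 : t * max (D - ρ) 0 ≤ t₁ * max (D - ρ) 0 := mul_le_mul_of_nonneg_right htt₁ hD''
      have h2 : t * (D - ρ) ≤ t * max (D - ρ) 0 := mul_le_mul_of_nonneg_left (le_max_left _ _) ht.le
      have h3 : t * (ρ : ℝ) / n ≤ t₁ := by
        rw [div_le_iff₀ hn]
        calc t * (ρ : ℝ) ≤ t * n := mul_le_mul_of_nonneg_left (by linarith) ht.le
          _ ≤ t₁ * n := mul_le_mul_of_nonneg_right htt₁ hn.le
      have h4 : (t * D - t * ρ) / n ≤ t₁ * max (D - ρ) 0 / n := div_le_div_of_nonneg_right (by linarith) hn.le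
      have h5 : (t * D - t * ρ) / n = t * D / n - t * ρ / n := by ring
      rw [h5] at h4
      linarith
    have hsα : ∀ {s : ℕ}, s ≤ ρ → ((s : ℝ) / n) ^ α ≤ W := fun {s} hs =>
      Real.rpow_le_rpow (by positivity) (div_le_div_of_nonneg_right (by exact_mod_cast hs) hn.le) hα0
    by_cases hcase : sf ≤ sb
    · -- forward leg (or trivial leg)
      have hlegdef : legHol U x₀ x₁ l = toC (axisHol U m sf w) := by
        rw [legHol, dif_pos hl]; simp only [← hm, ← hsf, ← hsb, if_pos hcase, hw]
      have hw'eq : w' = runSite w m sf := by rw [hw', hw, hsf, hm]; exact stairPt_succ_eq_runSite x₀ x₁ ⟨l, hl⟩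
      rcases Nat.eq_zero_or_pos sf with h0 | hpos
      · -- trivial leg
        have : w' = w := by rw [hw'eq, h0, runSite_zero]
        rw [hlegdef, h0, axisHol_zero, toC_one, one_mul, this, sub_self, norm_zero]; positivity
      · have hsfρ : sf ≤ ρ := by rw [min_eq_left hcase] at hmin; exact hmin
        have h := hlegP w m μ sf hpos (by omega) (hdeepw w (supDist_stairPt_le x₀ x₁ l)) f F (max (D - ρ) 0) hF
          (hsuppw w (supDist_stairPt_le x₀ x₁ l))
        rw [← hw'eq] at h
        rw [hlegdef]
        refine h.trans ?_
        calc c₁ * ((sf : ℝ) / (P.L : ℝ) ^ k) ^ α * P.spacing k * Real.exp (-(t₁ * max (D - ρ) 0 / (P.L : ℝ) ^ k)) * F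
            ≤ c₁ * W * P.spacing k * (Real.exp t₁ * E) * F := by rw [← hndef]; gcongr; exact hsα hsfρ
          _ = (c₁ * Real.exp t₁) * W * P.spacing k * E * F := by ring
    · -- backward leg
      push Not at hcase
      have hlegdef : legHol U x₀ x₁ l = conj (toC (axisHol U m sb w')) := by
        rw [legHol, dif_pos hl]; simp only [← hm, ← hsf, ← hsb, if_neg (not_le.2 hcase), hw']
      have hweq : w = runSite w' m sb := by rw [hw', hw, hsb, hm]; exact stairPt_eq_runSite_succ x₀ x₁ ⟨l, hl⟩
      have hsbρ : sb ≤ ρ := by rw [min_eq_right hcase.le] at hmin; exact hmin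
      have hsbpos : 0 < sb := by
        rcases Nat.eq_zero_or_pos sb with h0 | h
        · exfalso
          have hz : x₀ m - x₁ m = 0 := (ZMod.val_eq_zero _).1 h0
          have hsf0 : sf = 0 := by rw [hsf, show x₁ m - x₀ m = 0 by rw [← neg_sub, hz, neg_zero], ZMod.val_zero]
          omega
        · exact h
      have h := hlegP w' m μ sb hsbpos (by omega) (hdeepw w' (supDist_stairPt_le x₀ x₁ (l + 1))) f F (max (D - ρ) 0) hF
        (hsuppw w' (supDist_stairPt_le x₀ x₁ (l + 1)))
      rw [← hweq] at h
      -- `‖conj(a)·X(w′) − X(w)‖ = ‖a·X(w) − X(w′)‖`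
      have hnormeq : ‖conj (toC (axisHol U m sb w')) * X w' - X w‖ = ‖toC (axisHol U m sb w') * X w - X w'‖ := by
        set aa := toC (axisHol U m sb w') with haa
        have h1 : conj aa * aa = 1 := conj_mul_toC _
        have e : conj aa * X w' - X w = -(conj aa * (aa * X w - X w')) := by linear_combination (X w) * h1
        rw [e, norm_neg, norm_mul, Complex.norm_conj, haa, norm_toC, one_mul]
      rw [hlegdef, hnormeq]
      refine h.trans ?_
      calc c₁ * ((sb : ℝ) / (P.L : ℝ) ^ k) ^ α * P.spacing k * Real.exp (-(t₁ * max (D - ρ) 0 / (P.L : ℝ) ^ k)) * F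
          ≤ c₁ * W * P.spacing k * (Real.exp t₁ * E) * F := by rw [← hndef]; gcongr; exact hsα hsbρ
        _ = (c₁ * Real.exp t₁) * W * P.spacing k * E * F := by ring
  -- telescoping
  have htel := stair_telescope U x₀ x₁ X P.d
  rw [stairPt_zero, stairPt_of_le x₀ x₁ le_rfl] at htel
  calc ‖stairHol U x₀ x₁ * X x₁ - X x₀‖ = ‖(∏ l ∈ Finset.range P.d, legHol U x₀ x₁ l) * X x₁ - X x₀‖ := rfl
    _ ≤ ∑ l ∈ Finset.range P.d, ‖legHol U x₀ x₁ l * X (stairPt x₀ x₁ (l + 1)) - X (stairPt x₀ x₁ l)‖ := htel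
    _ ≤ ∑ _l ∈ Finset.range P.d, (c₁ * Real.exp t₁) * W * P.spacing k * E * F :=
        Finset.sum_le_sum fun l hl => hlegB l (Finset.mem_range.1 hl)
    _ = P.d * ((c₁ * Real.exp t₁) * W * P.spacing k * E * F) := by rw [Finset.sum_const, Finset.card_range, nsmul_eq_mul]
    _ = (P.d * (c₁ * Real.exp t₁)) * W * P.spacing k * E * F := by ring
    _ ≤ K * W * P.spacing k * E * F := by
        have : (P.d : ℝ) * (c₁ * Real.exp t₁) ≤ K := by
          rw [hKdef, hPdR]; linarith [show (0 : ℝ) ≤ 128 * c₂ by positivity]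
        gcongr

/-- **§3 IN THE (H1.9)-INPUT SHAPE OF THE HYPOTHESIS-FORM CHAIN** (p27's `holder19_smallField_cube_input` / p29's `holder19_flat_cube_level`
/ r01's `input19_holder_regular_deep` binders: distance `B5Ineq137Torus.T = |·−·|_∞`, one power of the spacing `L^kε`, rate `e^{−t₀(L^k)^{−1}D}`,
deep end points as the ball conditions `T(x_i, y) < 3L^k → y ∈ Ω`), for the REGION propagator on a general `k`-block union at a field with p34's
region hypotheses; the transport is p30's `stairHol`. [cite: BalabanImbrieJaffe1988, p.263; Balaban1983RegularityDecay, (1.9) p.573] -/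
theorem holder19_smallField_region_input (d L : ℕ) (hd1 : 1 ≤ d) (hd3 : d + 1 ≤ 3) (hL : Odd L ∧ 1 < L) {a : ℝ} (ha : 0 < a)
    {α : ℝ} (hα0 : 0 ≤ α) (hα1 : α < 1) :
    ∃ t₀ c₀ : ℝ, 0 < t₀ ∧ 0 < c₀ ∧ ∀ (P : Params), P.d = d + 1 → P.L = L →
      ∀ k : ℕ, 1 ≤ k → k ≤ P.K → ∀ Ω : Finset (Balaban1983to89.Site P 0), IsBlockUnion k Ω →
        ∀ (U : GaugeField P 0 U1) (θ T δ : ℝ), 0 ≤ θ →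
          (∀ p : Balaban1983to89.Plaq P 0, ‖toC (plaqHol U p) - 1‖ ≤ θ) →
          2 * (P.d : ℝ) ^ 3 * (((P.L : ℝ) ^ k) ^ 2 * θ) ^ 2 ≤ 1 →
          (∀ b ∈ starB Ω, blkIter k b.src = blkIter k b.tgt → ‖toC (U b) - 1‖ ≤ T) →
          (∀ y ∈ Ω, ‖holCK U k y - 1‖ ≤ δ) →
          2 * (((P.L : ℝ) ^ k - 1) * (P.L : ℝ) ^ k) * P.d * T ^ 2 + 2 * δ ^ 2 ≤ 1 / 2 →
        ∀ (μ : Fin P.d) (x₀ x₁ : Balaban1983to89.Site P 0), x₁ ≠ x₀ →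
          (∀ y, B5Ineq137Torus.T P 0 x₀ y < 3 * (P.L : ℝ) ^ k → y ∈ Ω) →
          (∀ y, B5Ineq137Torus.T P 0 x₁ y < 3 * (P.L : ℝ) ^ k → y ∈ Ω) →
        ∀ (f : Balaban1983to89.Site P 0 → ℂ) (F D : ℝ), (∀ y, ‖f y‖ ≤ F) →
          (∀ y, f y ≠ 0 → D ≤ B5Ineq137Torus.T P 0 x₀ y) → (∀ y, f y ≠ 0 → D ≤ B5Ineq137Torus.T P 0 x₁ y) →
          ((P.L : ℝ) ^ k / B5Ineq137Torus.T P 0 x₀ x₁) ^ α *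
              ‖stairHol U x₀ x₁ *
                  covD P.eps⁻¹ (cfg U) (gBox (B1RG242Torus.α P a k * (P.L : ℝ) ^ (k * P.d)) P.eps⁻¹ U k Ω *ᵥ f) ⟨x₁, μ⟩ -
                covD P.eps⁻¹ (cfg U) (gBox (B1RG242Torus.α P a k * (P.L : ℝ) ^ (k * P.d)) P.eps⁻¹ U k Ω *ᵥ f) ⟨x₀, μ⟩‖
            ≤ P.spacing k * (c₀ * Real.exp (-(t₀ * (((P.L : ℝ) ^ k)⁻¹ * D))) * F) := by
  obtain ⟨t₀, c₀, ht₀, hc₀, H⟩ := holder19_smallField_region d L hd1 hd3 hL ha hα0 hα1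
  refine ⟨t₀, c₀, ht₀, hc₀, ?_⟩
  intro P hPd hPL k hk1 hkK Ω hΩ U θ T δ hθ0 hθ hsmall hInt hTree hsmallT μ x₀ x₁ hne hdeep₀ hdeep₁ f F D hF hsupp₀ hsupp₁
  have hball : ∀ {x : Balaban1983to89.Site P 0},
      (∀ y, B5Ineq137Torus.T P 0 x y < 3 * (P.L : ℝ) ^ k → y ∈ Ω) →
      ∀ w, w ∉ Ω → 3 * P.L ^ k ≤ supDist x w := by
    intro x hdeep w hw
    by_contra hlt
    exact hw (hdeep w (by rw [B3Bound323ZeroTorus.T_eq_supDist]; exact_mod_cast (not_le.1 hlt)))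
  have h := H P hPd hPL k hk1 hkK Ω hΩ U θ T δ hθ0 hθ hsmall hInt hTree hsmallT x₀ x₁ μ hne.symm (hball hdeep₀) (hball hdeep₁)
    f F D hF (fun z hz => by
      rw [← B3Bound323ZeroTorus.T_eq_supDist, ← B3Bound323ZeroTorus.T_eq_supDist]; exact ⟨hsupp₀ z hz, hsupp₁ z hz⟩)
  rw [← B3Bound323ZeroTorus.T_eq_supDist] at h
  calc _ ≤ c₀ * P.spacing k * Real.exp (-(t₀ * D / (P.L : ℝ) ^ k)) * F := h
    _ = P.spacing k * (c₀ * Real.exp (-(t₀ * (((P.L : ℝ) ^ k)⁻¹ * D))) * F) := by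
        rw [show t₀ * D / (P.L : ℝ) ^ k = t₀ * (((P.L : ℝ) ^ k)⁻¹ * D) by ring]; ring

/-- **§3 IN THE (H6) BINDER SHAPE of p27 gen 38's `BIJ88LocDerivHolder231RegionOfInputs.derivHolder231_region_of_inputs_of_smooth`** — *«(H6)
the (1.9) Hölder-of-`D_u` member of `G_k(Ω,u)` at pairs of distinct `ρ`-deep rows of `Ω`»*: for every depth `ρ ≥ 3L^k`, all `x₁ ≠ x₂` in `Ω`
with `ρ ≤ T(x_i, w)` for every `w ∉ Ω`, every `g` with `‖g‖ ≤ F`, `0 ≤ D`, `D ≤ T(x_i, y)` on `supp g`: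
`(L^k/T(x₁,x₂))^α·‖stairHol u x₁ x₂·(D_uG_k(Ω,u)g)(x₂,μ) − (D_uG_k(Ω,u)g)(x₁,μ)‖ ≤ (L^kε)·(c₀e^{−t₀(L^k)⁻¹D}F)` — so that at a field with p34's
region hypotheses (H6) is THIS theorem after `intro`, for the general-region instance of the order-`1+θ` Hölder member of (2.31).
[cite: Balaban1983RegularityDecay, Theorem p.573 (1.9)] [cite: BalabanImbrieJaffe1988, (2.31) p.263 «Hölder derivatives of G_{k,loc}(u) of order less than two»] -/
theorem holder19_smallField_region_H6 (d L : ℕ) (hd1 : 1 ≤ d) (hd3 : d + 1 ≤ 3) (hL : Odd L ∧ 1 < L) {a : ℝ} (ha : 0 < a)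
    {α : ℝ} (hα0 : 0 ≤ α) (hα1 : α < 1) :
    ∃ t₀ c₀ : ℝ, 0 < t₀ ∧ 0 < c₀ ∧ ∀ (P : Params), P.d = d + 1 → P.L = L →
      ∀ k : ℕ, 1 ≤ k → k ≤ P.K → ∀ Ω : Finset (Balaban1983to89.Site P 0), IsBlockUnion k Ω →
        ∀ (U : GaugeField P 0 U1) (θ T δ : ℝ), 0 ≤ θ →
          (∀ p : Balaban1983to89.Plaq P 0, ‖toC (plaqHol U p) - 1‖ ≤ θ) →
          2 * (P.d : ℝ) ^ 3 * (((P.L : ℝ) ^ k) ^ 2 * θ) ^ 2 ≤ 1 →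
          (∀ b ∈ starB Ω, blkIter k b.src = blkIter k b.tgt → ‖toC (U b) - 1‖ ≤ T) →
          (∀ y ∈ Ω, ‖holCK U k y - 1‖ ≤ δ) →
          2 * (((P.L : ℝ) ^ k - 1) * (P.L : ℝ) ^ k) * P.d * T ^ 2 + 2 * δ ^ 2 ≤ 1 / 2 →
        ∀ (ρ : ℝ), 3 * (P.L : ℝ) ^ k ≤ ρ →
        ∀ (x₁ x₂ : Balaban1983to89.Site P 0) (μ : Fin P.d), x₁ ≠ x₂ → x₁ ∈ Ω → x₂ ∈ Ω →
          (∀ w, w ∉ Ω → ρ ≤ B5Ineq137Torus.T P 0 x₁ w) → (∀ w, w ∉ Ω → ρ ≤ B5Ineq137Torus.T P 0 x₂ w) →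
        ∀ (g : Balaban1983to89.Site P 0 → ℂ) (F D : ℝ), (∀ y, ‖g y‖ ≤ F) → 0 ≤ D →
          (∀ y, g y ≠ 0 → D ≤ B5Ineq137Torus.T P 0 x₁ y) → (∀ y, g y ≠ 0 → D ≤ B5Ineq137Torus.T P 0 x₂ y) →
          ((P.L : ℝ) ^ k / B5Ineq137Torus.T P 0 x₁ x₂) ^ α *
              ‖stairHol U x₁ x₂ * covD P.eps⁻¹ (cfg U) (gBox (B1RG242Torus.α P a k * (P.L : ℝ) ^ (k * P.d)) P.eps⁻¹ U k Ω *ᵥ g) ⟨x₂, μ⟩ -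
                covD P.eps⁻¹ (cfg U) (gBox (B1RG242Torus.α P a k * (P.L : ℝ) ^ (k * P.d)) P.eps⁻¹ U k Ω *ᵥ g) ⟨x₁, μ⟩‖ ≤
            P.spacing k * (c₀ * Real.exp (-(t₀ * (((P.L : ℝ) ^ k)⁻¹ * D))) * F) := by
  obtain ⟨t₀, c₀, ht₀, hc₀, H⟩ := holder19_smallField_region_input d L hd1 hd3 hL ha hα0 hα1
  refine ⟨t₀, c₀, ht₀, hc₀, ?_⟩
  intro P hPd hPL k hk1 hkK Ω hΩ U θ T δ hθ0 hθ hsmall hInt hTree hsmallT ρ hρ x₁ x₂ μ hne _hx₁ _hx₂ hdeep₁ hdeep₂ g F D hF _hD hsupp₁ hsupp₂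
  have hball : ∀ {x : Balaban1983to89.Site P 0}, (∀ w, w ∉ Ω → ρ ≤ B5Ineq137Torus.T P 0 x w) →
      ∀ y, B5Ineq137Torus.T P 0 x y < 3 * (P.L : ℝ) ^ k → y ∈ Ω := by
    intro x hdeep y hy
    by_contra hyΩ
    exact absurd ((hρ.trans (hdeep y hyΩ)).trans_lt hy) (lt_irrefl _)
  exact H P hPd hPL k hk1 hkK Ω hΩ U θ T δ hθ0 hθ hsmall hInt hTree hsmallT μ x₁ x₂ hne.symm (hball hdeep₁) (hball hdeep₂) g F D hF
    hsupp₁ hsupp₂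

end Main

/-! ## §4 The Hölder member under (7.3.1)-type plaquette smallness ONLY, threshold in `(d, L^k)`: the blockwise centred gauge -/

section Uniform

variable {d : ℕ}

/-- **THE HÖLDER MEMBER OF [6] (1.9) FOR THE REGION NEUMANN PROPAGATORS ON EVERY `k`-BLOCK UNION UNDER (7.3.1)-TYPE PLAQUETTE SMALLNESS WITH A
THRESHOLD DEPENDING ON `(d, L^k)` ONLY** — uniform in the region, the volume and the field — for [BalabanImbrieJaffe1985] p. 326 *"The
propagators arising from Δ_k(u_k), under the restriction (7.3.1) on the gauge field, also satisfy the regularity and decay estimates of [7]. … by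
change of gauge u_k can be transformed in a local region Λ into a configuration of the form exp[ie_kηA], where A is smooth and small"*: §3's
`holder19_smallField_region` with its bondwise `(T, δ)` hypotheses DISCHARGED — for `1 ≤ d`, `d+1 ≤ 3`, `L` odd `> 1`, `a > 0`, `0 ≤ α < 1` there
are `t₀, c₀ > 0` such that for every volume with `2(L^k−1)+4 < |T|`, every `1 ≤ k ≤ K`, every `U(1)` field with `‖u(∂p) − 1‖ ≤ θ` for all fine
plaquettes and `2(d+1)³(L^{2k}θ)² ≤ 1`, every `T ≥ d(L^k−1)θ` with `2(L^k−1)L^k(d+1)T² + 2((d+1)(L^k−1)T)² ≤ 1/2`, EVERY `k`-block union `Ω`, every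
pair `x₀ ≠ x₁` both `3L^k`-deep in `Ω`, every `μ` and every `f` with `|f| ≤ F` vanishing at sup-distance `< D` from `{x₀, x₁}`:
`(L^k/|x₀−x₁|_∞)^α·‖U(Γ_{x₀,x₁})(D_uG_k(Ω,u)f)(⟨x₁,μ⟩) − (D_uG_k(Ω,u)f)(⟨x₀,μ⟩)‖ ≤ c₀(L^kε)e^{−t₀D/L^k}F` — NO gauge condition, no ball.  Proof: the
change of gauge of p. 326 made block by block (p34's `smallField_blockGauge`: `u^h` meets the `(T, δ)` hypotheses with `δ = (d+1)(L^k−1)T`);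
plaquettes are gauge invariant; with `f = h·g`: `G_k(Ω,u^h)f = h·G_k(Ω,u)g` (p34 `gBox_gaugeAct_mulVec`), `D_{u^h}(hφ) = h·D_uφ` (p30
`covD_gaugeAct`), `U^h(Γ) = h(x₀)U(Γ)\overline{h(x₁)}` (p27 `stairHol_gaugeAct`) — the Hölder quantity for `(u^h, f)` is `h(x₀)` times that for
`(u, g)`; p27's `holder19_smallPlaquette_cube_uniform` proof verbatim.
[cite: BalabanImbrieJaffe1985, (7.3.1) p.326] [cite: Balaban1983RegularityDecay, Theorem p.573 (1.9)] [cite: BalabanImbrieJaffe1988, p.263] -/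
theorem holder19_smallPlaquette_region_uniform (d L : ℕ) (hd1 : 1 ≤ d) (hd3 : d + 1 ≤ 3) (hL : Odd L ∧ 1 < L) {a : ℝ} (ha : 0 < a)
    {α : ℝ} (hα0 : 0 ≤ α) (hα1 : α < 1) :
    ∃ t₀ c₀ : ℝ, 0 < t₀ ∧ 0 < c₀ ∧ ∀ (P : Params), P.d = d + 1 → P.L = L →
      ∀ k : ℕ, 1 ≤ k → k ≤ P.K → 2 * (P.L ^ k - 1) + 4 < P.sitesPerDir 0 →
      ∀ (U : GaugeField P 0 U1) (θ : ℝ), 0 ≤ θ →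
        (∀ p : Balaban1983to89.Plaq P 0, ‖toC (plaqHol U p) - 1‖ ≤ θ) →
        2 * (P.d : ℝ) ^ 3 * (((P.L : ℝ) ^ k) ^ 2 * θ) ^ 2 ≤ 1 →
        ∀ (T : ℝ), ((P.d - 1 : ℕ) : ℝ) * ((P.L : ℝ) ^ k - 1) * θ ≤ T →
          2 * (((P.L : ℝ) ^ k - 1) * (P.L : ℝ) ^ k) * P.d * T ^ 2 + 2 * (P.d * ((P.L : ℝ) ^ k - 1) * T) ^ 2 ≤ 1 / 2 →
        ∀ Ω : Finset (Balaban1983to89.Site P 0), IsBlockUnion k Ω →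
        ∀ (x₀ x₁ : Balaban1983to89.Site P 0) (μ : Fin P.d), x₀ ≠ x₁ →
          (∀ w, w ∉ Ω → 3 * P.L ^ k ≤ supDist x₀ w) →
          (∀ w, w ∉ Ω → 3 * P.L ^ k ≤ supDist x₁ w) →
        ∀ (f : Balaban1983to89.Site P 0 → ℂ) (F D : ℝ),
          (∀ z, ‖f z‖ ≤ F) → (∀ z, f z ≠ 0 → D ≤ (supDist x₀ z : ℝ) ∧ D ≤ (supDist x₁ z : ℝ)) →
          (((P.L : ℝ) ^ k / (supDist x₀ x₁ : ℝ)) ^ α *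
            ‖stairHol U x₀ x₁ *
                covD P.eps⁻¹ (cfg U) (gBox (B1RG242Torus.α P a k * (P.L : ℝ) ^ (k * P.d)) P.eps⁻¹ U k Ω *ᵥ f) ⟨x₁, μ⟩ -
              covD P.eps⁻¹ (cfg U) (gBox (B1RG242Torus.α P a k * (P.L : ℝ) ^ (k * P.d)) P.eps⁻¹ U k Ω *ᵥ f) ⟨x₀, μ⟩‖
            ≤ c₀ * P.spacing k * Real.exp (-(t₀ * D / (P.L : ℝ) ^ k)) * F) := by
  obtain ⟨t₀, c₀, ht₀, hc₀, H⟩ := holder19_smallField_region d L hd1 hd3 hL ha hα0 hα1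
  refine ⟨t₀, c₀, ht₀, hc₀, ?_⟩
  intro P hPd hPL k hk1 hkK hR U θ hθ0 hθ hsmall T hT hsmallT Ω hΩ x₀ x₁ μ hne hdeep₀ hdeep₁ f F D hF hsupp
  have hk : k ≤ P.m + P.K := hkK.trans (Nat.le_add_left _ _)
  have hk0 : 0 + k ≤ P.m + P.K := by omega
  have hL1 : (1 : ℝ) < P.L := B1RG242Torus.one_lt_cast_L P
  have ha' : 0 < B1RG242Torus.α P a k * (P.L : ℝ) ^ (k * P.d) :=
    mul_pos (mul_pos (B1.aSeq_pos ha hL1 hk1) (inv_pos.2 (pow_pos (P.spacing_pos k) 2))) (pow_pos P.cast_L_pos _)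
  have hc' : P.eps⁻¹ ≠ 0 := inv_ne_zero P.eps_pos.ne'
  -- the blockwise centred gauge supplies p34's block-local hypotheses
  set h : GaugeTransf P 0 U1 := fun z => centredGauge U (cornerIter k (blkIter k z)) (P.L ^ k - 1) z with hh
  obtain ⟨hInt, hTree⟩ := smallField_blockGauge (j := 0) hk0 U hθ0 hθ hR hT
  -- plaquettes of `u^h` are those of `u`
  set U' := gaugeAct h U with hU'
  have hθ' : ∀ p : Balaban1983to89.Plaq P 0, ‖toC (plaqHol U' p) - 1‖ ≤ θ := fun p => by
    rw [hU', norm_toC_plaqHol_gaugeAct_sub_one]; exact hθ p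
  have hS : stairHol U' x₀ x₁ = toC (h x₀) * stairHol U x₀ x₁ * conj (toC (h x₁)) := stairHol_gaugeAct h U x₀ x₁
  -- §3 at `u^h` for the rotated source `h·f`; its Hölder quantity is `h(x₀)` times the one for `(u, f)`
  have hF' : ∀ z, ‖(fun z => toC (h z) * f z) z‖ ≤ F := fun z => by
    show ‖toC (h z) * f z‖ ≤ F
    rw [norm_mul, norm_toC, one_mul]; exact hF z
  have hsupp' : ∀ z, (fun z => toC (h z) * f z) z ≠ 0 → D ≤ (supDist x₀ z : ℝ) ∧ D ≤ (supDist x₁ z : ℝ) := fun z hz =>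
    hsupp z (fun hf => hz (by show toC (h z) * f z = 0; rw [hf, mul_zero]))
  have hmain := H P hPd hPL k hk1 hkK Ω hΩ U' θ T (P.d * ((P.L : ℝ) ^ k - 1) * T) hθ0 hθ' hsmall
    (fun b hb hbb => hInt b hbb) (fun y _ => hTree y) hsmallT x₀ x₁ μ hne hdeep₀ hdeep₁ (fun z => toC (h z) * f z) F D hF' hsupp'
  -- the quantity for `(U', h·f)` is `h(x₀)` times the quantity for `(U, f)`
  set φf := gBox (B1RG242Torus.α P a k * (P.L : ℝ) ^ (k * P.d)) P.eps⁻¹ U k Ω *ᵥ f with hφf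
  have hGf' : gBox (B1RG242Torus.α P a k * (P.L : ℝ) ^ (k * P.d)) P.eps⁻¹ U' k Ω *ᵥ (fun z => toC (h z) * f z) =
      fun z => toC (h z) * φf z := gBox_gaugeAct_mulVec hk0 hc' ha' h U hΩ f
  have hD0' : covD P.eps⁻¹ (cfg U') (fun z => toC (h z) * φf z) ⟨x₀, μ⟩ = toC (h x₀) * covD P.eps⁻¹ (cfg U) φf ⟨x₀, μ⟩ :=
    covD_gaugeAct _ h U φf _
  have hD1' : covD P.eps⁻¹ (cfg U') (fun z => toC (h z) * φf z) ⟨x₁, μ⟩ = toC (h x₁) * covD P.eps⁻¹ (cfg U) φf ⟨x₁, μ⟩ :=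
    covD_gaugeAct _ h U φf _
  have hkey' : stairHol U' x₀ x₁ * covD P.eps⁻¹ (cfg U') (fun z => toC (h z) * φf z) ⟨x₁, μ⟩ -
      covD P.eps⁻¹ (cfg U') (fun z => toC (h z) * φf z) ⟨x₀, μ⟩ =
      toC (h x₀) * (stairHol U x₀ x₁ * covD P.eps⁻¹ (cfg U) φf ⟨x₁, μ⟩ - covD P.eps⁻¹ (cfg U) φf ⟨x₀, μ⟩) := by
    rw [hS, hD0', hD1']
    have h1 : conj (toC (h x₁)) * toC (h x₁) = 1 := conj_mul_toC _
    linear_combination (toC (h x₀) * stairHol U x₀ x₁ * covD P.eps⁻¹ (cfg U) φf ⟨x₁, μ⟩) * h1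
  have hnorm' : ‖stairHol U' x₀ x₁ *
        covD P.eps⁻¹ (cfg U') (gBox (B1RG242Torus.α P a k * (P.L : ℝ) ^ (k * P.d)) P.eps⁻¹ U' k Ω *ᵥ fun z => toC (h z) * f z) ⟨x₁, μ⟩ -
        covD P.eps⁻¹ (cfg U') (gBox (B1RG242Torus.α P a k * (P.L : ℝ) ^ (k * P.d)) P.eps⁻¹ U' k Ω *ᵥ fun z => toC (h z) * f z) ⟨x₀, μ⟩‖ =
      ‖stairHol U x₀ x₁ * covD P.eps⁻¹ (cfg U) φf ⟨x₁, μ⟩ - covD P.eps⁻¹ (cfg U) φf ⟨x₀, μ⟩‖ := by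
    rw [hGf', hkey', norm_mul, norm_toC, one_mul]
  rw [hnorm'] at hmain
  exact hmain

/-- **§4 IN THE (H1.9)-INPUT SHAPE**: the Hölder member for the REGION propagator under (7.3.1)-type plaquette smallness only, threshold in
`(d, L^k)`, in the binder shape of `holder19_smallField_region_input` (distance `B5Ineq137Torus.T`, `P.spacing k * (c₀ * exp(−t₀((L^k)⁻¹D)) * F)`,
deep end points as ball conditions), every `k`-block union. [cite: BalabanImbrieJaffe1985, (7.3.1) p.326; Balaban1983RegularityDecay, (1.9) p.573] -/
theorem holder19_smallPlaquette_region_uniform_input (d L : ℕ) (hd1 : 1 ≤ d) (hd3 : d + 1 ≤ 3) (hL : Odd L ∧ 1 < L) {a : ℝ}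
    (ha : 0 < a) {α : ℝ} (hα0 : 0 ≤ α) (hα1 : α < 1) :
    ∃ t₀ c₀ : ℝ, 0 < t₀ ∧ 0 < c₀ ∧ ∀ (P : Params), P.d = d + 1 → P.L = L →
      ∀ k : ℕ, 1 ≤ k → k ≤ P.K → 2 * (P.L ^ k - 1) + 4 < P.sitesPerDir 0 →
      ∀ (U : GaugeField P 0 U1) (θ : ℝ), 0 ≤ θ →
        (∀ p : Balaban1983to89.Plaq P 0, ‖toC (plaqHol U p) - 1‖ ≤ θ) →
        2 * (P.d : ℝ) ^ 3 * (((P.L : ℝ) ^ k) ^ 2 * θ) ^ 2 ≤ 1 →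
        ∀ (T : ℝ), ((P.d - 1 : ℕ) : ℝ) * ((P.L : ℝ) ^ k - 1) * θ ≤ T →
          2 * (((P.L : ℝ) ^ k - 1) * (P.L : ℝ) ^ k) * P.d * T ^ 2 + 2 * (P.d * ((P.L : ℝ) ^ k - 1) * T) ^ 2 ≤ 1 / 2 →
        ∀ Ω : Finset (Balaban1983to89.Site P 0), IsBlockUnion k Ω →
        ∀ (μ : Fin P.d) (x₀ x₁ : Balaban1983to89.Site P 0), x₁ ≠ x₀ →
          (∀ y, B5Ineq137Torus.T P 0 x₀ y < 3 * (P.L : ℝ) ^ k → y ∈ Ω) →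
          (∀ y, B5Ineq137Torus.T P 0 x₁ y < 3 * (P.L : ℝ) ^ k → y ∈ Ω) →
        ∀ (f : Balaban1983to89.Site P 0 → ℂ) (F D : ℝ), (∀ y, ‖f y‖ ≤ F) →
          (∀ y, f y ≠ 0 → D ≤ B5Ineq137Torus.T P 0 x₀ y) → (∀ y, f y ≠ 0 → D ≤ B5Ineq137Torus.T P 0 x₁ y) →
          ((P.L : ℝ) ^ k / B5Ineq137Torus.T P 0 x₀ x₁) ^ α *
              ‖stairHol U x₀ x₁ *
                  covD P.eps⁻¹ (cfg U) (gBox (B1RG242Torus.α P a k * (P.L : ℝ) ^ (k * P.d)) P.eps⁻¹ U k Ω *ᵥ f) ⟨x₁, μ⟩ -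
                covD P.eps⁻¹ (cfg U) (gBox (B1RG242Torus.α P a k * (P.L : ℝ) ^ (k * P.d)) P.eps⁻¹ U k Ω *ᵥ f) ⟨x₀, μ⟩‖
            ≤ P.spacing k * (c₀ * Real.exp (-(t₀ * (((P.L : ℝ) ^ k)⁻¹ * D))) * F) := by
  obtain ⟨t₀, c₀, ht₀, hc₀, H⟩ := holder19_smallPlaquette_region_uniform d L hd1 hd3 hL ha hα0 hα1
  refine ⟨t₀, c₀, ht₀, hc₀, ?_⟩
  intro P hPd hPL k hk1 hkK hR U θ hθ0 hθ hsmall T hT hsmallT Ω hΩ μ x₀ x₁ hne hdeep₀ hdeep₁ f F D hF hsupp₀ hsupp₁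
  have hball : ∀ {x : Balaban1983to89.Site P 0},
      (∀ y, B5Ineq137Torus.T P 0 x y < 3 * (P.L : ℝ) ^ k → y ∈ Ω) →
      ∀ w, w ∉ Ω → 3 * P.L ^ k ≤ supDist x w := by
    intro x hdeep w hw
    by_contra hlt
    exact hw (hdeep w (by rw [B3Bound323ZeroTorus.T_eq_supDist]; exact_mod_cast (not_le.1 hlt)))
  have h := H P hPd hPL k hk1 hkK hR U θ hθ0 hθ hsmall T hT hsmallT Ω hΩ x₀ x₁ μ hne.symm (hball hdeep₀) (hball hdeep₁)
    f F D hF (fun z hz => by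
      rw [← B3Bound323ZeroTorus.T_eq_supDist, ← B3Bound323ZeroTorus.T_eq_supDist]; exact ⟨hsupp₀ z hz, hsupp₁ z hz⟩)
  rw [← B3Bound323ZeroTorus.T_eq_supDist] at h
  calc _ ≤ c₀ * P.spacing k * Real.exp (-(t₀ * D / (P.L : ℝ) ^ k)) * F := h
    _ = P.spacing k * (c₀ * Real.exp (-(t₀ * (((P.L : ℝ) ^ k)⁻¹ * D))) * F) := by
        rw [show t₀ * D / (P.L : ℝ) ^ k = t₀ * (((P.L : ℝ) ^ k)⁻¹ * D) by ring]; ring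

/-- **§4 IN THE (H6) BINDER SHAPE of p27 gen 38's `derivHolder231_region_of_inputs_of_smooth`** (as `holder19_smallField_region_H6`, under
(7.3.1)-type fine-plaquette smallness only, threshold in `(d, L^k)`, every `k`-block union, every depth `ρ ≥ 3L^k`).
[cite: BalabanImbrieJaffe1985, (7.3.1) p.326] [cite: Balaban1983RegularityDecay, Theorem p.573 (1.9)] [cite: BalabanImbrieJaffe1988, (2.31) p.263] -/
theorem holder19_smallPlaquette_region_uniform_H6 (d L : ℕ) (hd1 : 1 ≤ d) (hd3 : d + 1 ≤ 3) (hL : Odd L ∧ 1 < L) {a : ℝ}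
    (ha : 0 < a) {α : ℝ} (hα0 : 0 ≤ α) (hα1 : α < 1) :
    ∃ t₀ c₀ : ℝ, 0 < t₀ ∧ 0 < c₀ ∧ ∀ (P : Params), P.d = d + 1 → P.L = L →
      ∀ k : ℕ, 1 ≤ k → k ≤ P.K → 2 * (P.L ^ k - 1) + 4 < P.sitesPerDir 0 →
      ∀ (U : GaugeField P 0 U1) (θ : ℝ), 0 ≤ θ →
        (∀ p : Balaban1983to89.Plaq P 0, ‖toC (plaqHol U p) - 1‖ ≤ θ) →
        2 * (P.d : ℝ) ^ 3 * (((P.L : ℝ) ^ k) ^ 2 * θ) ^ 2 ≤ 1 →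
        ∀ (T : ℝ), ((P.d - 1 : ℕ) : ℝ) * ((P.L : ℝ) ^ k - 1) * θ ≤ T →
          2 * (((P.L : ℝ) ^ k - 1) * (P.L : ℝ) ^ k) * P.d * T ^ 2 + 2 * (P.d * ((P.L : ℝ) ^ k - 1) * T) ^ 2 ≤ 1 / 2 →
        ∀ Ω : Finset (Balaban1983to89.Site P 0), IsBlockUnion k Ω →
        ∀ (ρ : ℝ), 3 * (P.L : ℝ) ^ k ≤ ρ →
        ∀ (x₁ x₂ : Balaban1983to89.Site P 0) (μ : Fin P.d), x₁ ≠ x₂ → x₁ ∈ Ω → x₂ ∈ Ω →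
          (∀ w, w ∉ Ω → ρ ≤ B5Ineq137Torus.T P 0 x₁ w) → (∀ w, w ∉ Ω → ρ ≤ B5Ineq137Torus.T P 0 x₂ w) →
        ∀ (g : Balaban1983to89.Site P 0 → ℂ) (F D : ℝ), (∀ y, ‖g y‖ ≤ F) → 0 ≤ D →
          (∀ y, g y ≠ 0 → D ≤ B5Ineq137Torus.T P 0 x₁ y) → (∀ y, g y ≠ 0 → D ≤ B5Ineq137Torus.T P 0 x₂ y) →
          ((P.L : ℝ) ^ k / B5Ineq137Torus.T P 0 x₁ x₂) ^ α *
              ‖stairHol U x₁ x₂ * covD P.eps⁻¹ (cfg U) (gBox (B1RG242Torus.α P a k * (P.L : ℝ) ^ (k * P.d)) P.eps⁻¹ U k Ω *ᵥ g) ⟨x₂, μ⟩ -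
                covD P.eps⁻¹ (cfg U) (gBox (B1RG242Torus.α P a k * (P.L : ℝ) ^ (k * P.d)) P.eps⁻¹ U k Ω *ᵥ g) ⟨x₁, μ⟩‖ ≤
            P.spacing k * (c₀ * Real.exp (-(t₀ * (((P.L : ℝ) ^ k)⁻¹ * D))) * F) := by
  obtain ⟨t₀, c₀, ht₀, hc₀, H⟩ := holder19_smallPlaquette_region_uniform_input d L hd1 hd3 hL ha hα0 hα1
  refine ⟨t₀, c₀, ht₀, hc₀, ?_⟩
  intro P hPd hPL k hk1 hkK hR U θ hθ0 hθ hsmall T hT hsmallT Ω hΩ ρ hρ x₁ x₂ μ hne _hx₁ _hx₂ hdeep₁ hdeep₂ g F D hF _hD hsupp₁ hsupp₂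
  have hball : ∀ {x : Balaban1983to89.Site P 0}, (∀ w, w ∉ Ω → ρ ≤ B5Ineq137Torus.T P 0 x w) →
      ∀ y, B5Ineq137Torus.T P 0 x y < 3 * (P.L : ℝ) ^ k → y ∈ Ω := by
    intro x hdeep y hy
    by_contra hyΩ
    exact absurd ((hρ.trans (hdeep y hyΩ)).trans_lt hy) (lt_irrefl _)
  exact H P hPd hPL k hk1 hkK hR U θ hθ0 hθ hsmall T hT hsmallT Ω hΩ μ x₁ x₂ hne.symm (hball hdeep₁) (hball hdeep₂) g F D hF hsupp₁ hsupp₂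

/-- kernel (the arithmetic of p31's `BIJ88DeltaLocSmallPlaquetteTorusCwt.smallness_of_threshold` — the statement of record — repeated
PRIVATELY to keep this propagator-level file below the (2.30)–(2.41) chain in the import order, exactly as p30 did in
`BIJ88NeumannPropagatorSmallFieldCloseRegion`): the block-scale plaquette threshold `(L^{2k}θ)² ≤ 1/500` implies, for `1 ≤ d′ ≤ 3`,
`2d′³(L^{2k}θ)² ≤ 1` and, with `T = (d′−1)(L^k−1)θ`, `2(L^k−1)L^k·d′·T² + 2(d′(L^k−1)T)² ≤ ½`. [cite: BalabanImbrieJaffe1985, (7.3.1) p.326] -/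
private theorem threshold_smallness' {dr n θ : ℝ} (hd1 : 1 ≤ dr) (hd3 : dr ≤ 3) (hn : 1 ≤ n) (hθ : 0 ≤ θ)
    (hτ : (n ^ 2 * θ) ^ 2 ≤ 1 / 500) :
    2 * dr ^ 3 * (n ^ 2 * θ) ^ 2 ≤ 1 ∧
      2 * ((n - 1) * n) * dr * ((dr - 1) * (n - 1) * θ) ^ 2 + 2 * (dr * (n - 1) * ((dr - 1) * (n - 1) * θ)) ^ 2 ≤ 1 / 2 := by
  have hd0 : 0 ≤ dr := by linarith
  have hn0 : 0 ≤ n := by linarith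
  have hd27 : dr ^ 3 ≤ 27 := by
    have h := pow_le_pow_left₀ hd0 hd3 3
    norm_num at h
    exact h
  have hd81 : dr ^ 4 ≤ 81 := by
    have h := pow_le_pow_left₀ hd0 hd3 4
    norm_num at h
    exact h
  have hτ0 : 0 ≤ (n ^ 2 * θ) ^ 2 := sq_nonneg _
  refine ⟨?_, ?_⟩
  · calc 2 * dr ^ 3 * (n ^ 2 * θ) ^ 2 ≤ 2 * 27 * (1 / 500) :=
          mul_le_mul (mul_le_mul_of_nonneg_left hd27 (by norm_num)) hτ hτ0 (by norm_num)
      _ ≤ 1 := by norm_num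
  · have hn1 : n - 1 ≤ n := by linarith
    have hdr1 : dr - 1 ≤ dr := by linarith
    have hn10 : 0 ≤ n - 1 := by linarith
    have hdr10 : 0 ≤ dr - 1 := by linarith
    calc 2 * ((n - 1) * n) * dr * ((dr - 1) * (n - 1) * θ) ^ 2 + 2 * (dr * (n - 1) * ((dr - 1) * (n - 1) * θ)) ^ 2
        ≤ 2 * (n * n) * dr * (dr * n * θ) ^ 2 + 2 * (dr * n * (dr * n * θ)) ^ 2 := by gcongr
      _ = (2 * dr ^ 3 + 2 * dr ^ 4) * (n ^ 2 * θ) ^ 2 := by ring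
      _ ≤ (2 * 27 + 2 * 81) * (1 / 500) := mul_le_mul (by linarith) hτ hτ0 (by norm_num)
      _ ≤ 1 / 2 := by norm_num

/-- **§4 IN THE (H6) BINDER SHAPE, IN THE `((L^k)²θ)² ≤ 1/500` / `plaqC` CURRENCY OF THE HYPOTHESIS-FREE REGION CHAIN** (p30's
`inputs110_smallPlaquette_region` / p27's `closeHolder112_smallPlaquette_region` / p29's `inputs_smallPlaquette_region`: parameters
`(d ℓ)`, `P.L = ℓ + 1` odd, `1 ≤ k ≤ K`, `2(L^k−1)+4 < |T|`, `‖plaqC u y μ ν − 1‖ ≤ θ`, `0 ≤ θ`, `((L^k)²θ)² ≤ 1/500`) — the [6] (1.9)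
Hölder-of-`D_u` member of `G_k(Ω,u)` for EVERY `k`-block union `Ω`, every depth `ρ ≥ 3L^k`, all pairs of distinct `ρ`-deep rows, transport
`stairHol`: so that the general-region instance of the order-`1+θ` Hölder member of (2.31) (p27 gen 38's FILE 1b) takes (H6) from this theorem
BY NAME in the same currency as (H1)–(H5).  Proof: §4 `holder19_smallPlaquette_region_uniform_H6` at `T = d(L^k−1)θ`, the two side
conditions from the threshold (the arithmetic of p31's `smallness_of_threshold`), plaquettes `plaqC ↦ plaqHol` by `plaqC_eq_toC_plaqHol`.
[cite: BalabanImbrieJaffe1985, (7.3.1) p.326] [cite: Balaban1983RegularityDecay, Theorem p.573 (1.9)] [cite: BalabanImbrieJaffe1988, (2.31) p.263] -/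
theorem holder19_smallPlaquette_region_H6_of500 (d ℓ : ℕ) (hd1 : 1 ≤ d) (hd3 : d + 1 ≤ 3) (hℓ : 1 ≤ ℓ) (hodd : Odd (ℓ + 1))
    {a : ℝ} (ha : 0 < a) {α : ℝ} (hα0 : 0 ≤ α) (hα1 : α < 1) :
    ∃ t₀ c₀ : ℝ, 0 < t₀ ∧ 0 < c₀ ∧ ∀ (P : Params), P.d = d + 1 → P.L = ℓ + 1 →
      ∀ k : ℕ, 1 ≤ k → k ≤ P.K → 2 * (P.L ^ k - 1) + 4 < P.sitesPerDir 0 →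
      ∀ (U : GaugeField P 0 U1) (θ : ℝ), 0 ≤ θ →
        (∀ (y : Balaban1983to89.Site P 0) (μ ν : Fin P.d), ‖BIJ85AbelianStokes.plaqC U y μ ν - 1‖ ≤ θ) →
        (((P.L : ℝ) ^ k) ^ 2 * θ) ^ 2 ≤ 1 / 500 →
        ∀ Ω : Finset (Balaban1983to89.Site P 0), IsBlockUnion k Ω →
        ∀ (ρ : ℝ), 3 * (P.L : ℝ) ^ k ≤ ρ →
        ∀ (x₁ x₂ : Balaban1983to89.Site P 0) (μ : Fin P.d), x₁ ≠ x₂ → x₁ ∈ Ω → x₂ ∈ Ω →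
          (∀ w, w ∉ Ω → ρ ≤ B5Ineq137Torus.T P 0 x₁ w) → (∀ w, w ∉ Ω → ρ ≤ B5Ineq137Torus.T P 0 x₂ w) →
        ∀ (g : Balaban1983to89.Site P 0 → ℂ) (F D : ℝ), (∀ y, ‖g y‖ ≤ F) → 0 ≤ D →
          (∀ y, g y ≠ 0 → D ≤ B5Ineq137Torus.T P 0 x₁ y) → (∀ y, g y ≠ 0 → D ≤ B5Ineq137Torus.T P 0 x₂ y) →
          ((P.L : ℝ) ^ k / B5Ineq137Torus.T P 0 x₁ x₂) ^ α *
              ‖stairHol U x₁ x₂ * covD P.eps⁻¹ (cfg U) (gBox (B1RG242Torus.α P a k * (P.L : ℝ) ^ (k * P.d)) P.eps⁻¹ U k Ω *ᵥ g) ⟨x₂, μ⟩ -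
                covD P.eps⁻¹ (cfg U) (gBox (B1RG242Torus.α P a k * (P.L : ℝ) ^ (k * P.d)) P.eps⁻¹ U k Ω *ᵥ g) ⟨x₁, μ⟩‖ ≤
            P.spacing k * (c₀ * Real.exp (-(t₀ * (((P.L : ℝ) ^ k)⁻¹ * D))) * F) := by
  obtain ⟨t₀, c₀, ht₀, hc₀, H⟩ := holder19_smallPlaquette_region_uniform_H6 d (ℓ + 1) hd1 hd3 ⟨hodd, by omega⟩ ha hα0 hα1
  refine ⟨t₀, c₀, ht₀, hc₀, ?_⟩
  intro P hPd hPL k hk1 hkK hbig U θ hθ0 hθ hτ Ω hΩ ρ hρ x₁ x₂ μ hne hx₁ hx₂ hdeep₁ hdeep₂ g F D hF hD hsupp₁ hsupp₂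
  have hLr : (1 : ℝ) ≤ (P.L : ℝ) ^ k := one_le_pow₀ (B1RG242Torus.one_lt_cast_L P).le
  have hdr : (P.d : ℝ) = (d : ℝ) + 1 := by rw [hPd]; push_cast; ring
  have hd1r : (1 : ℝ) ≤ P.d := by rw [hdr]; linarith [(Nat.cast_nonneg d : (0 : ℝ) ≤ d)]
  have hd3r : (P.d : ℝ) ≤ 3 := by rw [hPd]; exact_mod_cast hd3
  obtain ⟨hsm1, hsm2⟩ := threshold_smallness' hd1r hd3r hLr hθ0 hτ
  have hplaq : ∀ p : Balaban1983to89.Plaq P 0, ‖toC (plaqHol U p) - 1‖ ≤ θ := by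
    rintro ⟨y, μ', ν, hμν⟩
    rw [← BIJ85AbelianStokes.plaqC_eq_toC_plaqHol U y hμν]; exact hθ y μ' ν
  have hT : ((P.d - 1 : ℕ) : ℝ) * ((P.L : ℝ) ^ k - 1) * θ ≤ ((P.d : ℝ) - 1) * ((P.L : ℝ) ^ k - 1) * θ := by
    rw [Nat.cast_sub P.hd, Nat.cast_one]
  exact H P hPd hPL k hk1 hkK hbig U θ hθ0 hplaq hsm1 _ hT hsm2 Ω hΩ ρ hρ x₁ x₂ μ hne hx₁ hx₂ hdeep₁ hdeep₂ g F D hF hD hsupp₁ hsupp₂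

end Uniform

/-! ## §5 The Hölder member at the ACTUAL BACKGROUND `u_k` of (4.5.4) under the printed (7.3.1), every `k`-block union -/

section ActualBackground

variable {d : ℕ}

/-- **[7] (1.9), HÖLDER MEMBER (order `1 + α`, `0 ≤ α < 1`), `k`-UNIFORM OPERATOR FORM, FOR `D_{u_k}G_k(Ω,u_k)` ON EVERY `k`-BLOCK UNION AT THE
ACTUAL BACKGROUND UNDER THE PRINTED (7.3.1)** — for [BalabanImbrieJaffe1985] p. 326 *"let us assume that for the unit lattice field v, |v(∂p) − 1| ≦
e_k𝓅(e_k), (7.3.1) … The propagators arising from Δ_k(u_k), under the restriction (7.3.1) on the gauge field, also satisfy the regularity and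
decay estimates of [7]"*: for `D = d + 1 ∈ {2, 3}`, `L` odd `> 1`, `a > 0`, exponent `𝓅`, `0 ≤ α < 1` there are `c₁ > 0` (`= 1/(23D²K(D, L))`) and
`t₀, c₀ > 0` (from `(d, L, a, α)`) such that for EVERY torus, every `1 ≤ k ≤ K` with `2(L^k − 1) + 4 < |T|`, every coupling `0 < e ≤ 1` with
`e𝓅(e) ≤ c₁`, every unit field `v` with (7.3.1) `‖v(∂q) − 1‖ ≤ e𝓅(e)` for all `q`, EVERY union `Ω` of `k`-blocks, all `x₀ ≠ x₁` both
`3L^k`-deep in `Ω`, every `μ`, every `f` with `‖f‖ ≤ F` vanishing at sup-distance `< D` from `{x₀, x₁}`: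
`(L^k/|x₀−x₁|_∞)^α·‖U(Γ)(D_{u_k}G_k(Ω,u_k)f)(⟨x₁,μ⟩) − (D_{u_k}G_k(Ω,u_k)f)(⟨x₀,μ⟩)‖ ≤ (L^kε)·c₀e^{−t₀D/L^k}·F`, `u_k = actualBgU1 hd2 k e v`,
transport = p30's `stairHol` — §4 `holder19_smallPlaquette_region_uniform` ∘ p34 gen 19's passage `smallPlaquette_actualBg` (θ = K·e𝓅(e)/(L^k)²;
p33's all-tori `K_R` inside).  The REGION twin of gen 19's `holder19_cube_actualBg` (`BIJ88NeumannPropagatorActualBackgroundCube`).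
[cite: BalabanImbrieJaffe1985, (7.3.1) p.326 «also satisfy the regularity and decay estimates of [7]», (4.5.4) p.313]
[cite: Balaban1983RegularityDecay, Theorem p.573 (1.9)] [cite: BalabanImbrieJaffe1988, p.263 «Hölder derivatives of G_{k,loc}(u) of order less than two»] -/
theorem holder19_region_actualBg (d L : ℕ) (hd1 : 1 ≤ d) (hd3 : d + 1 ≤ 3) (hL : Odd L ∧ 1 < L) {a : ℝ} (ha : 0 < a) (pexp : ℝ)
    {α : ℝ} (hα0 : 0 ≤ α) (hα1 : α < 1) :
    ∃ c₁ t₀ c₀ : ℝ, 0 < c₁ ∧ 0 < t₀ ∧ 0 < c₀ ∧ ∀ (P : Params), P.d = d + 1 → P.L = L →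
      ∀ (hd2 : 2 ≤ P.d) (k : ℕ), 1 ≤ k → k ≤ P.K → 2 * (P.L ^ k - 1) + 4 < P.sitesPerDir 0 →
      ∀ (e : ℝ), 0 < e → e ≤ 1 → e * (1 + Real.log e⁻¹) ^ pexp ≤ c₁ →
      ∀ (v : BIJ85Sect1Model.U1Field P k),
        (∀ q : Balaban1983to89.Plaq P k, ‖((BIJ85Sect1Model.plaq v q : Circle) : ℂ) - 1‖ ≤ e * (1 + Real.log e⁻¹) ^ pexp) →
      ∀ Ω : Finset (Balaban1983to89.Site P 0), IsBlockUnion k Ω →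
        ∀ (x₀ x₁ : Balaban1983to89.Site P 0) (μ : Fin P.d), x₀ ≠ x₁ →
          (∀ w, w ∉ Ω → 3 * P.L ^ k ≤ supDist x₀ w) → (∀ w, w ∉ Ω → 3 * P.L ^ k ≤ supDist x₁ w) →
        ∀ (f : Balaban1983to89.Site P 0 → ℂ) (F D : ℝ),
          (∀ z, ‖f z‖ ≤ F) → (∀ z, f z ≠ 0 → D ≤ (supDist x₀ z : ℝ) ∧ D ≤ (supDist x₁ z : ℝ)) →
          (((P.L : ℝ) ^ k / (supDist x₀ x₁ : ℝ)) ^ α *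
            ‖stairHol (actualBgU1 hd2 k e v) x₀ x₁ *
                covD P.eps⁻¹ (cfg (actualBgU1 hd2 k e v))
                  (gBox (B1RG242Torus.α P a k * (P.L : ℝ) ^ (k * P.d)) P.eps⁻¹ (actualBgU1 hd2 k e v) k Ω *ᵥ f) ⟨x₁, μ⟩ -
              covD P.eps⁻¹ (cfg (actualBgU1 hd2 k e v))
                  (gBox (B1RG242Torus.α P a k * (P.L : ℝ) ^ (k * P.d)) P.eps⁻¹ (actualBgU1 hd2 k e v) k Ω *ᵥ f) ⟨x₀, μ⟩‖
            ≤ c₀ * P.spacing k * Real.exp (-(t₀ * D / (P.L : ℝ) ^ k)) * F) := by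
  obtain ⟨K, hK1, HK⟩ := smallPlaquette_actualBg (d := d + 1) (L := L) (by omega) pexp
  obtain ⟨t₀, c₀, ht₀, hc₀, H⟩ := holder19_smallPlaquette_region_uniform d L hd1 hd3 hL ha hα0 hα1
  refine ⟨1 / (23 * ((d : ℝ) + 1) ^ 2 * K), t₀, c₀, by positivity, ht₀, hc₀, ?_⟩
  intro P hPd hPL hd2 k hk1 hkK hbig e he he1 hsm v hv Ω hΩ x₀ x₁ μ hne hdeep₀ hdeep₁ f F D hF hsupp
  have hk : k ≤ P.m + P.K := hkK.trans (Nat.le_add_left _ _)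
  have hdr : (P.d : ℝ) = (d : ℝ) + 1 := by rw [hPd]; push_cast; ring
  rw [← hdr] at hsm
  obtain ⟨hθ0, -, hplaq, h1, hT, h2, -⟩ := HK P hPd hPL hd2 k hk1 hk e he he1 hsm v hv
  exact H P hPd hPL k hk1 hkK hbig (actualBgU1 hd2 k e v) _ hθ0 hplaq h1 _ hT h2 Ω hΩ x₀ x₁ μ hne hdeep₀ hdeep₁ f F D hF hsupp

/-- **§5 IN THE (H6) BINDER SHAPE of p27 gen 38's `derivHolder231_region_of_inputs_of_smooth`, AT THE ACTUAL BACKGROUND `u_k` UNDER THE PRINTED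
(7.3.1)** (depth `ρ ≥ 3L^k` as `∀ w ∉ Ω, ρ ≤ T(x_i, w)`, distance `B5Ineq137Torus.T`, `0 ≤ D`, two one-sided support conditions, bound
`(L^kε)·(c₀e^{−t₀(L^k)⁻¹D}F)`) — the (H6) input of the order-`1+θ` Hölder member of (2.31) for `G_{k,loc}(u_k) − G_k(Ω,u_k)` on a general region.
[cite: BalabanImbrieJaffe1985, (7.3.1) p.326, (4.5.4) p.313] [cite: Balaban1983RegularityDecay, Theorem p.573 (1.9)] [cite: BalabanImbrieJaffe1988, (2.31) p.263] -/
theorem holder19_region_actualBg_H6 (d L : ℕ) (hd1 : 1 ≤ d) (hd3 : d + 1 ≤ 3) (hL : Odd L ∧ 1 < L) {a : ℝ} (ha : 0 < a) (pexp : ℝ)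
    {α : ℝ} (hα0 : 0 ≤ α) (hα1 : α < 1) :
    ∃ c₁ t₀ c₀ : ℝ, 0 < c₁ ∧ 0 < t₀ ∧ 0 < c₀ ∧ ∀ (P : Params), P.d = d + 1 → P.L = L →
      ∀ (hd2 : 2 ≤ P.d) (k : ℕ), 1 ≤ k → k ≤ P.K → 2 * (P.L ^ k - 1) + 4 < P.sitesPerDir 0 →
      ∀ (e : ℝ), 0 < e → e ≤ 1 → e * (1 + Real.log e⁻¹) ^ pexp ≤ c₁ →
      ∀ (v : BIJ85Sect1Model.U1Field P k),
        (∀ q : Balaban1983to89.Plaq P k, ‖((BIJ85Sect1Model.plaq v q : Circle) : ℂ) - 1‖ ≤ e * (1 + Real.log e⁻¹) ^ pexp) →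
      ∀ Ω : Finset (Balaban1983to89.Site P 0), IsBlockUnion k Ω →
        ∀ (ρ : ℝ), 3 * (P.L : ℝ) ^ k ≤ ρ →
        ∀ (x₁ x₂ : Balaban1983to89.Site P 0) (μ : Fin P.d), x₁ ≠ x₂ → x₁ ∈ Ω → x₂ ∈ Ω →
          (∀ w, w ∉ Ω → ρ ≤ B5Ineq137Torus.T P 0 x₁ w) → (∀ w, w ∉ Ω → ρ ≤ B5Ineq137Torus.T P 0 x₂ w) →
        ∀ (g : Balaban1983to89.Site P 0 → ℂ) (F D : ℝ), (∀ y, ‖g y‖ ≤ F) → 0 ≤ D →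
          (∀ y, g y ≠ 0 → D ≤ B5Ineq137Torus.T P 0 x₁ y) → (∀ y, g y ≠ 0 → D ≤ B5Ineq137Torus.T P 0 x₂ y) →
          ((P.L : ℝ) ^ k / B5Ineq137Torus.T P 0 x₁ x₂) ^ α *
              ‖stairHol (actualBgU1 hd2 k e v) x₁ x₂ *
                  covD P.eps⁻¹ (cfg (actualBgU1 hd2 k e v))
                    (gBox (B1RG242Torus.α P a k * (P.L : ℝ) ^ (k * P.d)) P.eps⁻¹ (actualBgU1 hd2 k e v) k Ω *ᵥ g) ⟨x₂, μ⟩ -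
                covD P.eps⁻¹ (cfg (actualBgU1 hd2 k e v))
                    (gBox (B1RG242Torus.α P a k * (P.L : ℝ) ^ (k * P.d)) P.eps⁻¹ (actualBgU1 hd2 k e v) k Ω *ᵥ g) ⟨x₁, μ⟩‖ ≤
            P.spacing k * (c₀ * Real.exp (-(t₀ * (((P.L : ℝ) ^ k)⁻¹ * D))) * F) := by
  obtain ⟨K, hK1, HK⟩ := smallPlaquette_actualBg (d := d + 1) (L := L) (by omega) pexp
  obtain ⟨t₀, c₀, ht₀, hc₀, H⟩ := holder19_smallPlaquette_region_uniform_H6 d L hd1 hd3 hL ha hα0 hα1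
  refine ⟨1 / (23 * ((d : ℝ) + 1) ^ 2 * K), t₀, c₀, by positivity, ht₀, hc₀, ?_⟩
  intro P hPd hPL hd2 k hk1 hkK hbig e he he1 hsm v hv Ω hΩ ρ hρ x₁ x₂ μ hne hx₁ hx₂ hdeep₁ hdeep₂ g F D hF hD hsupp₁ hsupp₂
  have hk : k ≤ P.m + P.K := hkK.trans (Nat.le_add_left _ _)
  have hdr : (P.d : ℝ) = (d : ℝ) + 1 := by rw [hPd]; push_cast; ring
  rw [← hdr] at hsm
  obtain ⟨hθ0, -, hplaq, h1, hT, h2, -⟩ := HK P hPd hPL hd2 k hk1 hk e he he1 hsm v hv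
  exact H P hPd hPL k hk1 hkK hbig (actualBgU1 hd2 k e v) _ hθ0 hplaq h1 _ hT h2 Ω hΩ ρ hρ x₁ x₂ μ hne hx₁ hx₂ hdeep₁ hdeep₂ g F D hF hD
    hsupp₁ hsupp₂

end ActualBackground

end

end Literature.MathematicalPhysics.QuantumFieldTheory.BalabanImbrieJaffe1984to88.BIJ88NeumannPropagatorSmallFieldRegionHolder
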